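import Literature.MathematicalPhysics.QuantumFieldTheory.Balaban1983to89.B1Eq324BenfattoClassSectEMemberPrecisionDoorOnLambdaStarSmall
import Literature.MathematicalPhysics.QuantumFieldTheory.Balaban1983to89.B1Eq324BenfattoClassSectEMemberPrecisionDoorAtOneStarAssembled
import Literature.MathematicalPhysics.QuantumFieldTheory.Balaban1983to89.Node00.OpsYSectEStarRecordP
import Literature.MathematicalPhysics.QuantumFieldTheory.Balaban1983to89.Node00.CarriersYP

/-!
# `Balaban1983to89.B1Eq324BenfattoClassSectEMemberPrecisionDoorRecordV4P` — THE (3.24) STAR DOORS OF RECORD RE-KEYED TO NODE 00's v4P LETTERS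
# `lettersYOfRecordV4P` (Sect. D composites fed print's site propagator `G′_phys = η²·G′_latt`), THE RECORD NODE N06's CERTIFICATE AND THE K1 FACE PIN
# (seat dag-n08-d g41, CHECK-M (RECORD ∕ G′-UNITS) + INTENT-100, seat dag-n08-b g39 «YOURS (r1)»; node N08 [Balaban1985UV3], row `h324c`)

statement-level companion of published sources with citation tags; every declaration here is a theorem; nothing here is a claim about the
Yang–Mills mass gap

T. Bałaban, *Propagators for lattice gauge theories in a background field*, Commun. Math. Phys. **99** (1985) 389–434 [Balaban1985BackgroundPropagators] (= [B9]):
(3.24)–(3.27) pp. 394–395 (`G′`, `R`, `Δ_a`, `G`), (3.119)–(3.132) pp. 419–422 (the Sect. D composites `Δ_π, G̃, (QG̃Q*)⁻¹, H, G₁, (QG₁Q*)⁻¹, H₁`), Sect. E (3.155)–(3.158)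
pp. 427–428 (`Δ_k(U) = (QG₁Q*)⁻¹ − a − ⟨D̃⁽²⁾·,J⟩`, `C̃^{(k)} = (C*Δ_kC)⁻¹`); *Ultraviolet stability of three-dimensional lattice pure gauge field theories*, CMP **102** (1985)
255–275 [Balaban1985UV3], (24) p. 262; *Propagators and renormalization transformations II*, CMP **96** (1984) 223–250 [Balaban1984PropagatorsII] (= [4]), (2.3) p. 224,
Lemma 2.4 p. 245, (2.153) p. 249; *Averaging operations for lattice gauge theories*, CMP **98** (1985) 17–51 [Balaban1985Averaging] (= [5]), (125)–(126) p. 36;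
*(Higgs)₂,₃ quantum fields in a finite volume I*, CMP **85** (1982) 603–636 [Balaban1982Higgs1], (3.24) p. 616; G. Benfatto et al., CMP **59** (1978) 143–166
[BenfattoEtAl1978], Lemma (4.5)–(4.7) p. 152.

WHY THIS MODULE (cell `pub-ymgap`, seat `dag-n08-d` gen 41, CHECK-M; memo `pub-ymgap-dag-n08-d/N08-CHECK-M-RECORD-g41.md`).  NODE 00 carries TWO letter records that differ
ONLY in which site propagator `G′(U)` is fed to the seven Sect. D composites: the v4 record `Node00.OpsYRecordV4.lettersYOfRecordV4` feeds the LATTICE `GpY`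
(`covLettersY_v4_QG1Qinv`), the v4P record `Node00.OpsYRecordV4P.lettersYOfRecordV4P` feeds print's `GpPhysY = η²·GpY` (`covLettersY_v4P_QG1Qinv`).  By def-Y's located
word (`Node00.OpsYGpUnits`, dag-n06-l LOCATED-UNITS-D1, 2026-08-27) the composites «denote print's operators only when fed `G′_phys`; at `GpY` the projector term
`D_U G′ R D*_U` is `L^{2k}` times print's», and «every Sect. D letter at `U = 1` equals the one at `GpY`» (`lettersYOfRecordV4P_one`).  Node N06's certificate of record
(dag-n06-d ED.66–72), the K1 face of node N24 and def-Y's star record `opsYNuStOfRecordV4PE` pin the v4P letters; the (3.24) star doors of record landed 08-28∕29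
(`…PrecisionDoorOnLambdaStar` §4, `…PrecisionDoorOnLambdaStarSmall`, `…PrecisionDoorRowsByNameStar`, `…PrecisionDoorAtOneStarAssembled`) pin v4.  The Sect. E star
operators read the record ONLY through `𝔏.QG1Qinv` (`deltaKstY x 𝔏 𝔢 U := 𝔏.QG1Qinv U − aY − 𝔢.D2J U`), so:
* §1 ★ `lettersYOfRecordV4P_QG1Qinv_isSymmTr` — (R1′) at the v4P record (def-Y's generic `OpsYSectDESymm.QG1QinvY_isSymmTr` at the tables `parSymY ∕ parBY ∕ GpPhysY (parSymY)`,
  with `isSymmTr_GpPhysY_parSymY` ∕ `RY_GpPhysY_parSymY_isSymmTr`);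
* §2 ★ the `U = 1` TRANSFER `deltaKstY ∕ deltaKPstY ∕ CsDeltaCstY ∕ CsDeltaCPstY ∕ CtildeKstY ∕ CtildeKPstY ∕ CkStY ∕ CkPstY x (lettersYOfRecordV4P … x) 𝔢 1 = … (lettersYOfRecordV4 … x) 𝔢 1`
  (one `congrArg` on `lettersYOfRecordV4P_one`), and ★★★ `eq324_CsDeltaCPstY_lettersYOfRecordV4P_sectEStYOfRecordV7_trBasis_one_on_unit` — seat n08-b's assembled `U = 1` star
  door (p702939: EVERY member, NO analytic row) now literally about the record N06 certifies;
* §3 ★★ the (3.132) P-row dictionary at the v4P records `opsYNuOfRecordV4PE` ∕ `opsYNuStOfRecordV4PE` (instances of seat n08-d's record-free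
  `…PRowDictionaryAtNode00.pRowTop∕pRowOnΛst_of_ineq3132_nu`), and ★★★ THE SOCKET FORM `pRowOnΛst_family_of_b9LeafX_opsYNuStOfRecordV4PE` — the door's print-unit P-row on
  STAR pairs READ FROM node N06's leaf of record `h06 : B9LeafX (Y9OfRecordP N θ M⋆ (opsYNuStOfRecordV4PE N θ M⋆ 𝔯 𝔢 𝔴 𝔈))` (its field `s3132`), the same socket the K1 face
  of node N24 and node N07 consume;
* §4 ★★★ the GENERAL-background star doors of record RE-KEYED to the v4P letters — seat n08-b's p702005 §4 (`…_of_units_onΛst_on_unit`) and p704589 §1–§3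
  (`…_of_small…`, `…_of_ineq3132_of_small…`, family form) VERBATIM with `lettersYOfRecordV4 ↦ lettersYOfRecordV4P`, the row-26 field read at def-Y's STAR v4P record
  `opsYNuStOfRecordV4PE` and the family form at print's class `bg9YP` (seat n08-b's word «YOURS (r1)», bus 2026-08-29T07:49:06Z; proofs theirs, credited), and ★★★★
  `…_of_b9LeafX_of_small_onΛst_on_unit` — THE (3.24) STAR DOOR OF RECORD MODULO NODE N06's SOCKET OF RECORD `h06 : B9LeafX (Y9OfRecordP N θ M⋆ (opsYNuStOfRecordV4PE …))`
  (the P-row is `h06.s3132`; displayed per background: the small averaged field of record, [5]'s reality rows, the 𝒥-row on STAR pairs at print's rate, the Δ_k-row `γ₀`).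

HONEST SCOPE.  Count-neutral bookkeeping + compositions BY NAME over def-Y's letters; no estimate of [B9] ∕ [4] ∕ [5] ∕ [BenfattoEtAl1978] ∕ [Balaban1985UV3] is proved or
asserted here beyond what the tree proves; the v4-keyed general-background doors stay correct implications about the letters they name; the IDENT for row `h324c` is NOT
made; node N06 ∕ N08 NOT discharged; one finite 𝕋^{d+1} programme — nothing about d = 4 specifically, the continuum, OS axioms, a mass gap or the Clay problem.  No `sorry`,
no `def`, no `instance`, no `notation`.
-/

noncomputable section

open MeasureTheory Finset Matrix
open scoped Matrix.Norms.L2Operator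

namespace Literature.MathematicalPhysics.QuantumFieldTheory.Balaban1983to89.B1Eq324BenfattoClassSectEMemberPrecisionDoorRecordV4P

open Literature.MathematicalPhysics.QuantumFieldTheory
open Literature.MathematicalPhysics.QuantumFieldTheory.Balaban1983to89.B1Eq324BenfattoLemma
open Literature.MathematicalPhysics.QuantumFieldTheory.Balaban1983to89.Node00
open Literature.MathematicalPhysics.QuantumFieldTheory.Balaban1983to89.DagBinding (B9LeafX PrintedCarriers9X)
open B6KLevelCensusIndexV1 (KIdx)
open B6Ineq2142KLevelV1 (lvl)
open B9PinMembersKLevelV1 (MemberY geo9Y bg9Y)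
open B9BackgroundsKLevelV1P (bg9YP)
open B9PinCarriersKLevelV1P (siteKernelP)
open B9PinGeometryKLevelV1 (unitDistY)
open B9Thm311ReadingCoords (trIP IsSymmTr)
open B9Thm311ProjectionR (RY_parSymY_isSymmTr)
open B9CoReadingCoordsTranspose (trReForm TrIdx trBasis)
open B7Prop2Explicit (unitaryUnits)
open B7Prop2SpecialUnitary (specialUnitaryUnits specialUnitaryUnits_le_unitaryUnits)
open B9Eq3132NuReading (siteKernelOfOpNu nuY opsYNuOfRecordV4E)
open B1Eq324BenfattoClassSectEMemberPRowDictionaryAtNode00 (pRowTop_of_ineq3132_nu pRowOnΛst_of_ineq3132_nu)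
open B1Eq324BenfattoClassSectEMemberPrecisionDoorAtOneStarAssembled (eq324_CsDeltaCPstY_sectEStYOfRecordV7_trBasis_one_on_unit)

/-! ## §1  (R1′) at the v4P record: `(QG₁Q*)⁻¹(U)` with `G′_phys` in the composites is trace-symmetric -/

section Symm

variable {N : ℕ} (θ : Stage3Params) (Mstar : ℕ) (𝔯 : ResY N θ Mstar)

/-- ★ **THE v4P RECORD's `(QG₁Q*)⁻¹(U)` IS SYMMETRIC** at every `G`-valued configuration, `G ≤ U(N)`, at which the residual letter `(𝔯 x).Δ2` is — the `QG1Qinv`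
companion of def-Y's `lettersYOfRecordV4P_G₁_isSymmTr ∕ _GG_isSymmTr` (def-Y's `QG1QinvY_isSymmTr` at the tables `parSymY ∕ parBY ∕ GpPhysY (parSymY)`; the v4 twin is
seat n08-b's `…RealAdjointAtNode00.lettersYOfRecordV4_QG1Qinv_isSymmTr`). [cite: Balaban1985BackgroundPropagators, (3.132) p.422, Thm 3.11 p.416, (3.24)–(3.25) p.394, (3.35) p.396] -/
theorem lettersYOfRecordV4P_QG1Qinv_isSymmTr {G : Subgroup (Matrix (Fin N) (Fin N) ℂ)ˣ} (hG : G ≤ unitaryUnits (Matrix (Fin N) (Fin N) ℂ))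
    (x : MemberY θ.d₆ θ.ℓ₆ θ.hd' θ.hL' θ.b₀ θ.b₁ Mstar) {U : CfgY (Matrix (Fin N) (Fin N) ℂ) x.toKIdx} (hU : ∀ μ z, U μ z ∈ G)
    (hΔ2 : IsSymmTr (fun _ => (1 : ℝ)) ((𝔯 x).Δ2 U)) :
    IsSymmTr (fun _ => (1 : ℝ)) ((lettersYOfRecordV4P N θ Mstar 𝔯 x).QG1Qinv U) :=
  QG1QinvY_isSymmTr x.toKIdx (parSymY x.toKIdx) (parBY x.toKIdx) (GpPhysY x.toKIdx (parSymY x.toKIdx)) (𝔯 x).Δ2 U hG hU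
    (fun s s' => parBY_mem x.toKIdx hU s s') (isSymmTr_GpPhysY_parSymY x.toKIdx hG hU) (RY_GpPhysY_parSymY_isSymmTr x.toKIdx hG hU) hΔ2

end Symm

/-! ## §2  The `U = 1` transfer: every Sect. E star operator at the v4P record IS the one at the v4 record at `U = 1` -/

section TransferOne

variable {N : ℕ} (θ : Stage3Params) (Mstar : ℕ) (𝔯 : ResY N θ Mstar) (x : MemberY θ.d₆ θ.ℓ₆ θ.hd' θ.hL' θ.b₀ θ.b₁ Mstar)
  (𝔢 : SectELettersStY (Matrix (Fin N) (Fin N) ℂ) x)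

/-- `Δ_k(1)` (flat) at the v4P record is the v4 record's (`deltaKstY` reads the record only through `(QG₁Q*)⁻¹`, equal at `U = 1` by `lettersYOfRecordV4P_one`).
[cite: Balaban1985BackgroundPropagators, (3.156) p.428, (3.132) p.422, Cor. 3.5 p.407] -/
theorem deltaKstY_lettersYOfRecordV4P_one :
    deltaKstY x (lettersYOfRecordV4P N θ Mstar 𝔯 x) 𝔢 (fun _ _ => 1) = deltaKstY x (lettersYOfRecordV4 N θ Mstar 𝔯 x) 𝔢 (fun _ _ => 1) := by
  simp only [deltaKstY, (lettersYOfRecordV4P_one N θ Mstar 𝔯 x).2.2.2.2.1]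

/-- `Δ_k(1)` (print units) at the v4P record is the v4 record's. [cite: Balaban1985BackgroundPropagators, (3.156) p.428, Cor. 3.5 p.407] -/
theorem deltaKPstY_lettersYOfRecordV4P_one :
    deltaKPstY x (lettersYOfRecordV4P N θ Mstar 𝔯 x) 𝔢 (fun _ _ => 1) = deltaKPstY x (lettersYOfRecordV4 N θ Mstar 𝔯 x) 𝔢 (fun _ _ => 1) := by
  simp only [deltaKPstY, deltaKstY_lettersYOfRecordV4P_one]

/-- `C_st*Δ_kC_st(1)` (flat) at the v4P record is the v4 record's. [cite: Balaban1985BackgroundPropagators, (3.157) p.428, Cor. 3.5 p.407] -/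
theorem CsDeltaCstY_lettersYOfRecordV4P_one :
    CsDeltaCstY x (lettersYOfRecordV4P N θ Mstar 𝔯 x) 𝔢 (fun _ _ => 1) = CsDeltaCstY x (lettersYOfRecordV4 N θ Mstar 𝔯 x) 𝔢 (fun _ _ => 1) := by
  simp only [CsDeltaCstY, deltaKstY_lettersYOfRecordV4P_one]

/-- ★ `η^{d+1}·C_st*Δ_kC_st(1)` (print units) at the v4P record is the v4 record's — the covariance letter of the `U = 1` doors.
[cite: Balaban1985BackgroundPropagators, (3.157) p.428, Cor. 3.5 p.407] -/
theorem CsDeltaCPstY_lettersYOfRecordV4P_one :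
    CsDeltaCPstY x (lettersYOfRecordV4P N θ Mstar 𝔯 x) 𝔢 (fun _ _ => 1) = CsDeltaCPstY x (lettersYOfRecordV4 N θ Mstar 𝔯 x) 𝔢 (fun _ _ => 1) := by
  simp only [CsDeltaCPstY, CsDeltaCstY_lettersYOfRecordV4P_one]

/-- `C̃^{(k)}(1)` (flat) at the v4P record is the v4 record's. [cite: Balaban1985BackgroundPropagators, (3.157) p.428, Cor. 3.5 p.407] -/
theorem CtildeKstY_lettersYOfRecordV4P_one :
    CtildeKstY x (lettersYOfRecordV4P N θ Mstar 𝔯 x) 𝔢 (fun _ _ => 1) = CtildeKstY x (lettersYOfRecordV4 N θ Mstar 𝔯 x) 𝔢 (fun _ _ => 1) := by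
  simp only [CtildeKstY, CsDeltaCstY_lettersYOfRecordV4P_one]

/-- `C̃^{(k)}(1)` (print units) at the v4P record is the v4 record's. [cite: Balaban1985BackgroundPropagators, (3.157) p.428, Cor. 3.5 p.407] -/
theorem CtildeKPstY_lettersYOfRecordV4P_one :
    CtildeKPstY x (lettersYOfRecordV4P N θ Mstar 𝔯 x) 𝔢 (fun _ _ => 1) = CtildeKPstY x (lettersYOfRecordV4 N θ Mstar 𝔯 x) 𝔢 (fun _ _ => 1) := by
  simp only [CtildeKPstY, CtildeKstY_lettersYOfRecordV4P_one]

/-- `C^{(k)}(Λ; 1)` (flat, (3.185)) at the v4P record is the v4 record's. [cite: Balaban1985BackgroundPropagators, (3.185) p.432, Cor. 3.5 p.407] -/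
theorem CkStY_lettersYOfRecordV4P_one :
    CkStY x (lettersYOfRecordV4P N θ Mstar 𝔯 x) 𝔢 (fun _ _ => 1) = CkStY x (lettersYOfRecordV4 N θ Mstar 𝔯 x) 𝔢 (fun _ _ => 1) := by
  simp only [CkStY, CtildeKstY_lettersYOfRecordV4P_one]

/-- `C^{(k)}(Λ; 1)` (print units) at the v4P record is the v4 record's. [cite: Balaban1985BackgroundPropagators, (3.185) p.432, Cor. 3.5 p.407] -/
theorem CkPstY_lettersYOfRecordV4P_one :
    CkPstY x (lettersYOfRecordV4P N θ Mstar 𝔯 x) 𝔢 (fun _ _ => 1) = CkPstY x (lettersYOfRecordV4 N θ Mstar 𝔯 x) 𝔢 (fun _ _ => 1) := by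
  simp only [CkPstY, CkStY_lettersYOfRecordV4P_one]

end TransferOne

section DoorOne

/-- ★★★ **[Balaban1982Higgs1] (3.24) ∕ [Balaban1985UV3] (24) FOR `𝒩(0, 𝕄_ι(η^{d+1}C_st*Δ_kC_st(1))⁻¹)` AT NODE 00's v4P STAR LETTERS OF RECORD — THE RECORD NODE N06's
CERTIFICATE PINS — `U = 1`, EVERY MEMBER, NO ANALYTIC ROW LEFT**: seat n08-b's `…PrecisionDoorAtOneStarAssembled.eq324_CsDeltaCPstY_sectEStYOfRecordV7_trBasis_one_on_unit`
VERBATIM with `lettersYOfRecordV4 ↦ lettersYOfRecordV4P` in the precision letter, transported by §2's `CsDeltaCPstY_lettersYOfRecordV4P_one` (the seven Sect. D composites of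
the two records agree at `U = 1`, def-Y `lettersYOfRecordV4P_one`).
[cite: Balaban1985UV3, (24) p.262, pp.271–272; Balaban1982Higgs1, (3.24) p.616; BenfattoEtAl1978, Lemma (4.5)–(4.7) p.152; Balaban1985BackgroundPropagators,
(3.155)–(3.158) pp.427–428, (3.132) p.422, Cor. 3.5 p.407, Thm 3.11 p.416; Balaban1984PropagatorsII, (2.149) p.249, (2.153)–(2.156) pp.249–250, Lemma 2.4 p.245, (2.3) p.224
(class form; bent window, presentation and coordinates ours)] -/
theorem eq324_CsDeltaCPstY_lettersYOfRecordV4P_sectEStYOfRecordV7_trBasis_one_on_unit (N : ℕ) [NeZero N] (θ : Stage3Params) (hD : 2 ≤ θ.d₆ + 1) (hℓ : 4 ≤ θ.ℓ₆)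
    (Mstar : ℕ) (𝔯 : ResY N θ Mstar) (𝔢₀ : SectEY N θ Mstar) (t D : ℕ) {ϰ : ℝ} (hϰ : 0 < ϰ)
    {p₀ σ' c κ' : ℝ} (hp₀ : 2 / 3 < p₀) (hσ : 0 < σ') (hc : 0 ≤ c) (hκ : 0 < κ') (hκσ : κ' < σ' * (t + 1)) :
    ∃ M₆ b₁ : ℝ, ∀ b₀ : ℝ, b₁ < b₀ → ∃ C : ℝ, 0 ≤ C ∧ ∀ η : ℝ, 0 < η → η ≤ 1 →
      ∀ (x : MemberY θ.d₆ θ.ℓ₆ θ.hd' θ.hL' θ.b₀ θ.b₁ Mstar) [DecidableEq (IBondY x.toKIdx)], M₆ ≤ (geo9Y x).M →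
      ∀ {σ : Type} [Fintype σ] [DecidableEq σ] [Nonempty σ] (ι : σ → IBondY x.toKIdx), Function.Injective ι → (∀ s, lamTstY x (ι s)) →
      ∃ (Λ : Finset (B1Eq324BenfattoLemma.Site (θ.d₆ + 1 + (θ.d₆ + 1) + 1))) (e' : σ × TrIdx N ≃ ↥Λ),
        ((gaussianFieldOfKernel fun u w => if h : u ∈ Λ ∧ w ∈ Λ then
            ((Matrix.reindex e' e'
              (Matrix.of fun p q : σ × TrIdx N =>
                  trReForm (trBasis N p.2) (((CsDeltaCPstY x (lettersYOfRecordV4P N θ Mstar 𝔯 x)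
            (sectEStYOfRecordV7 N θ Mstar 𝔢₀ x) (fun _ _ => 1)).restrictScalars ℝ)
                    (Pi.single (ι q.1) (trBasis N q.2)) (ι p.1))))⁻¹ :
                Matrix ↥Λ ↥Λ ℝ) ⟨u, h.1⟩ ⟨w, h.2⟩ else 0).map
            (fun (z : B1Eq324BenfattoLemma.Site (θ.d₆ + 1 + (θ.d₆ + 1) + 1) → ℝ) (q : σ × TrIdx N) => z ((e' q : ↥Λ) : B1Eq324BenfattoLemma.Site (θ.d₆ + 1 + (θ.d₆ + 1) + 1))) =
          gaussianFieldOfKernel fun p q =>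
            ((Matrix.of fun p q : σ × TrIdx N =>
                trReForm (trBasis N p.2) (((CsDeltaCPstY x (lettersYOfRecordV4P N θ Mstar 𝔯 x)
            (sectEStYOfRecordV7 N θ Mstar 𝔢₀ x) (fun _ _ => 1)).restrictScalars ℝ)
                  (Pi.single (ι q.1) (trBasis N q.2)) (ι p.1)))⁻¹ :
              Matrix (σ × TrIdx N) (σ × TrIdx N) ℝ) p q) ∧
        (∀ p : ℝ, 0 ≤ p →
          ((fun (z : B1Eq324BenfattoLemma.Site (θ.d₆ + 1 + (θ.d₆ + 1) + 1) → ℝ) (q : σ × TrIdx N) => z ((e' q : ↥Λ) : B1Eq324BenfattoLemma.Site (θ.d₆ + 1 + (θ.d₆ + 1) + 1))) ⁻¹'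
              {ω : σ × TrIdx N → ℝ | ∀ q, |ω q| ≤ p}) =ᵐ[gaussianFieldOfKernel fun u w => if h : u ∈ Λ ∧ w ∈ Λ then
                ((Matrix.reindex e' e'
                  (Matrix.of fun p q : σ × TrIdx N =>
                      trReForm (trBasis N p.2) (((CsDeltaCPstY x (lettersYOfRecordV4P N θ Mstar 𝔯 x)
            (sectEStYOfRecordV7 N θ Mstar 𝔢₀ x) (fun _ _ => 1)).restrictScalars ℝ)
                        (Pi.single (ι q.1) (trBasis N q.2)) (ι p.1))))⁻¹ :
                    Matrix ↥Λ ↥Λ ℝ) ⟨u, h.1⟩ ⟨w, h.2⟩ else 0]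
            smallFieldSet Λ p) ∧
        ∀ (s : ℕ) (I J : Finset (B1Eq324BenfattoLemma.Site (θ.d₆ + 1 + (θ.d₆ + 1) + 1))) (𝔞 : Coef (θ.d₆ + 1 + (θ.d₆ + 1) + 1)),
          I.Nonempty → J ⊆ I → J ⊆ Λ → coefSup s D 𝔞 J ≤ c * η ^ σ' →
          0 < ∫ z, cutoffBoltzmann (hamiltonian s D ϰ 𝔞 J) I (B10.pFun b₀ p₀ η) z ∂(gaussianFieldOfKernel fun u w => if h : u ∈ Λ ∧ w ∈ Λ then
              ((Matrix.reindex e' e'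
                (Matrix.of fun p q : σ × TrIdx N =>
                    trReForm (trBasis N p.2) (((CsDeltaCPstY x (lettersYOfRecordV4P N θ Mstar 𝔯 x)
            (sectEStYOfRecordV7 N θ Mstar 𝔢₀ x) (fun _ _ => 1)).restrictScalars ℝ)
                      (Pi.single (ι q.1) (trBasis N q.2)) (ι p.1))))⁻¹ :
                  Matrix ↥Λ ↥Λ ℝ) ⟨u, h.1⟩ ⟨w, h.2⟩ else 0) ∧
            |Real.log (∫ z, cutoffBoltzmann (hamiltonian s D ϰ 𝔞 J) I (B10.pFun b₀ p₀ η) z ∂(gaussianFieldOfKernel fun u w =>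
                if h : u ∈ Λ ∧ w ∈ Λ then
                  ((Matrix.reindex e' e'
                    (Matrix.of fun p q : σ × TrIdx N =>
                        trReForm (trBasis N p.2) (((CsDeltaCPstY x (lettersYOfRecordV4P N θ Mstar 𝔯 x)
            (sectEStYOfRecordV7 N θ Mstar 𝔢₀ x) (fun _ _ => 1)).restrictScalars ℝ)
                          (Pi.single (ι q.1) (trBasis N q.2)) (ι p.1))))⁻¹ :
                      Matrix ↥Λ ↥Λ ℝ) ⟨u, h.1⟩ ⟨w, h.2⟩ else 0)) -
              cumulantSum (gaussianFieldOfKernel fun u w => if h : u ∈ Λ ∧ w ∈ Λ then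
                  ((Matrix.reindex e' e'
                    (Matrix.of fun p q : σ × TrIdx N =>
                        trReForm (trBasis N p.2) (((CsDeltaCPstY x (lettersYOfRecordV4P N θ Mstar 𝔯 x)
            (sectEStYOfRecordV7 N θ Mstar 𝔢₀ x) (fun _ _ => 1)).restrictScalars ℝ)
                          (Pi.single (ι q.1) (trBasis N q.2)) (ι p.1))))⁻¹ :
                      Matrix ↥Λ ↥Λ ℝ) ⟨u, h.1⟩ ⟨w, h.2⟩ else 0)
                (hamiltonian s D ϰ 𝔞 J) t| ≤ C * η ^ κ' * I.card := by
  simp only [CsDeltaCPstY_lettersYOfRecordV4P_one]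
  exact eq324_CsDeltaCPstY_sectEStYOfRecordV7_trBasis_one_on_unit N θ hD hℓ Mstar 𝔯 𝔢₀ t D hϰ hp₀ hσ hc hκ hκσ

end DoorOne

/-! ## §3  The (3.132) P-row dictionary at the v4P records, and the SOCKET form from node N06's leaf of record -/

section PRowRecordP

variable {N : ℕ} (θ : Stage3Params) (Mstar' : ℕ) (𝔯 : ResY N θ Mstar') (𝔢 : SectEY N θ Mstar') (𝔢st : SectEStY N θ Mstar')
  (𝔴 : RWEY N θ Mstar') (𝔈 : ExpsY N θ Mstar')

/-- ★★ **AT THE v4P RECORD, PER BACKGROUND, ANY TWO TOP-LEVEL BONDS**: the (3.132) reading of the row-26 field `(opsYNuOfRecordV4PE N θ M⋆ 𝔯 𝔢 𝔴 𝔈 x).QG1Qinv` at `U`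
with constants `(C, δ₁)` gives the print-unit door's P-row for `(lettersYOfRecordV4P N θ M⋆ 𝔯 x).QG1Qinv U` (the `(QG₁Q*)⁻¹(U)` fed `G′_phys`) on top-level pairs.
[cite: Balaban1985BackgroundPropagators, (3.132) p.422, (3.155) p.427; Balaban1984PropagatorsII, (2.149) p.249; Balaban1985UV3, (24) p.262] -/
theorem pRowTop_opsYNuOfRecordV4PE_of_ineq3132 (x : MemberY θ.d₆ θ.ℓ₆ θ.hd' θ.hL' θ.b₀ θ.b₁ Mstar') (dd : ℕ) {C δ₁ : ℝ} (hC : 0 ≤ C) (hδ₁ : 0 ≤ δ₁)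
    (U : (bg9Y (Matrix (Fin N) (Fin N) ℂ) (specialUnitaryUnits (Fin N)) x).Cfg)
    (h : B9.Ineq3132 dd ((opsYNuOfRecordV4PE N θ Mstar' 𝔯 𝔢 𝔴 𝔈 x).QG1Qinv) C δ₁ U)
    {u v : IBondY x.toKIdx} (hu : lvl x.hN x.D x.hk u = x.k) (hv : lvl x.hN x.D x.hk v = x.k) :
    (⨆ E : BallY (Matrix (Fin N) (Fin N) ℂ),
        ‖(((((((θ.ℓ₆ + 1 : ℕ) : ℝ)) ^ x.k)⁻¹ ^ (θ.d₆ + 1) : ℝ) : ℂ) • (lettersYOfRecordV4P N θ Mstar' 𝔯 x).QG1Qinv U)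
          (deltaY v (E : Matrix (Fin N) (Fin N) ℂ)) u‖) ≤ C * Real.exp (-(δ₁ * unitDistY x u v)) := by
  rw [(opsYNuOfRecordV4PE_QGQinv_QG1Qinv N θ Mstar' 𝔯 𝔢 𝔴 𝔈 x).2] at h
  exact pRowTop_of_ineq3132_nu x _ dd (θ.d₆ + 1) hC hδ₁ U h hu hv

/-- ★★ **AT THE v4P RECORD, PER BACKGROUND, STAR PAIRS** (`inΛstY`). [cite: Balaban1985BackgroundPropagators, (3.132) p.422, (3.155) p.427; Balaban1984PropagatorsII, (2.3) p.224, (2.149) p.249; Balaban1985UV3, (24) p.262] -/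
theorem pRowOnΛst_opsYNuOfRecordV4PE_of_ineq3132 (x : MemberY θ.d₆ θ.ℓ₆ θ.hd' θ.hL' θ.b₀ θ.b₁ Mstar') (dd : ℕ) {C δ₁ : ℝ} (hC : 0 ≤ C) (hδ₁ : 0 ≤ δ₁)
    (U : (bg9Y (Matrix (Fin N) (Fin N) ℂ) (specialUnitaryUnits (Fin N)) x).Cfg)
    (h : B9.Ineq3132 dd ((opsYNuOfRecordV4PE N θ Mstar' 𝔯 𝔢 𝔴 𝔈 x).QG1Qinv) C δ₁ U)
    {u v : IBondY x.toKIdx} (hu : inΛstY x u) (hv : inΛstY x v) :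
    (⨆ E : BallY (Matrix (Fin N) (Fin N) ℂ),
        ‖(((((((θ.ℓ₆ + 1 : ℕ) : ℝ)) ^ x.k)⁻¹ ^ (θ.d₆ + 1) : ℝ) : ℂ) • (lettersYOfRecordV4P N θ Mstar' 𝔯 x).QG1Qinv U)
          (deltaY v (E : Matrix (Fin N) (Fin N) ℂ)) u‖) ≤ C * Real.exp (-(δ₁ * unitDistY x u v)) :=
  pRowTop_opsYNuOfRecordV4PE_of_ineq3132 θ Mstar' 𝔯 𝔢 𝔴 𝔈 x dd hC hδ₁ U h hu.1 hv.1

/-- ★★ **AT THE v4P STAR RECORD `opsYNuStOfRecordV4PE`** (def-Y `Node00.OpsYSectEStarRecordP`, the record node N06's STAR-edition certificate instantiates), PER BACKGROUND,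
ANY TWO TOP-LEVEL BONDS. [cite: Balaban1985BackgroundPropagators, (3.132) p.422, (3.155) p.427; Balaban1984PropagatorsII, (2.149) p.249; Balaban1985UV3, (24) p.262] -/
theorem pRowTop_opsYNuStOfRecordV4PE_of_ineq3132 (x : MemberY θ.d₆ θ.ℓ₆ θ.hd' θ.hL' θ.b₀ θ.b₁ Mstar') (dd : ℕ) {C δ₁ : ℝ} (hC : 0 ≤ C) (hδ₁ : 0 ≤ δ₁)
    (U : (bg9Y (Matrix (Fin N) (Fin N) ℂ) (specialUnitaryUnits (Fin N)) x).Cfg)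
    (h : B9.Ineq3132 dd ((opsYNuStOfRecordV4PE N θ Mstar' 𝔯 𝔢st 𝔴 𝔈 x).QG1Qinv) C δ₁ U)
    {u v : IBondY x.toKIdx} (hu : lvl x.hN x.D x.hk u = x.k) (hv : lvl x.hN x.D x.hk v = x.k) :
    (⨆ E : BallY (Matrix (Fin N) (Fin N) ℂ),
        ‖(((((((θ.ℓ₆ + 1 : ℕ) : ℝ)) ^ x.k)⁻¹ ^ (θ.d₆ + 1) : ℝ) : ℂ) • (lettersYOfRecordV4P N θ Mstar' 𝔯 x).QG1Qinv U)
          (deltaY v (E : Matrix (Fin N) (Fin N) ℂ)) u‖) ≤ C * Real.exp (-(δ₁ * unitDistY x u v)) := by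
  rw [(opsYNuStOfRecordV4PE_QGQinv_QG1Qinv N θ Mstar' 𝔯 𝔢st 𝔴 𝔈 x).2] at h
  exact pRowTop_of_ineq3132_nu x _ dd (θ.d₆ + 1) hC hδ₁ U h hu hv

/-- ★★ **AT THE v4P STAR RECORD, PER BACKGROUND, STAR PAIRS** (`inΛstY`) — the (R2′a) row of the star doors of record at the v4P letters, from the (3.132) reading of the
row-26 field of the record node N06 certifies. [cite: Balaban1985BackgroundPropagators, (3.132) p.422, (3.155) p.427; Balaban1984PropagatorsII, (2.3) p.224, (2.149) p.249; Balaban1985UV3, (24) p.262] -/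
theorem pRowOnΛst_opsYNuStOfRecordV4PE_of_ineq3132 (x : MemberY θ.d₆ θ.ℓ₆ θ.hd' θ.hL' θ.b₀ θ.b₁ Mstar') (dd : ℕ) {C δ₁ : ℝ} (hC : 0 ≤ C) (hδ₁ : 0 ≤ δ₁)
    (U : (bg9Y (Matrix (Fin N) (Fin N) ℂ) (specialUnitaryUnits (Fin N)) x).Cfg)
    (h : B9.Ineq3132 dd ((opsYNuStOfRecordV4PE N θ Mstar' 𝔯 𝔢st 𝔴 𝔈 x).QG1Qinv) C δ₁ U)
    {u v : IBondY x.toKIdx} (hu : inΛstY x u) (hv : inΛstY x v) :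
    (⨆ E : BallY (Matrix (Fin N) (Fin N) ℂ),
        ‖(((((((θ.ℓ₆ + 1 : ℕ) : ℝ)) ^ x.k)⁻¹ ^ (θ.d₆ + 1) : ℝ) : ℂ) • (lettersYOfRecordV4P N θ Mstar' 𝔯 x).QG1Qinv U)
          (deltaY v (E : Matrix (Fin N) (Fin N) ℂ)) u‖) ≤ C * Real.exp (-(δ₁ * unitDistY x u v)) :=
  pRowTop_opsYNuStOfRecordV4PE_of_ineq3132 θ Mstar' 𝔯 𝔢st 𝔴 𝔈 x dd hC hδ₁ U h hu.1 hv.1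

/-- ★★ **AT THE v4P STAR RECORD, FAMILY FORM ON STAR PAIRS, print's class `bg9YP`**: the (3.132) CLAIM `B9.Stmt3132Printed` for the two row-26 fields of
`opsYNuStOfRecordV4PE …` over print's cube class (`bg9YP`, `regYP335 ∕ regYP336`) gives, with ONE pair `(C, δ₁)` and under print's thresholds ∕ regularity, the
print-unit P-row on `inΛstY` pairs for `(lettersYOfRecordV4P N θ M⋆ 𝔯 x).QG1Qinv U` at every member.  The hypothesis is read through `siteKernelP` (def-Y's
`B9PinCarriersKLevelV1P`: same kernel over the re-sized class), exactly the shape of the field `s3132` of `B9LeafX (Y9OfRecordP N θ M⋆ (opsYNuStOfRecordV4PE …))`.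
[cite: Balaban1985BackgroundPropagators, (3.132) p.422, Thm 3.12 p.423, (3.35)–(3.36) p.396; Balaban1984PropagatorsII, (2.3) p.224, (2.149) p.249; Balaban1985UV3, (24) p.262] -/
theorem pRowOnΛst_family_opsYNuStOfRecordV4PE_P
    (h : B9.Stmt3132Printed (θ.d₆ + 1) B9PinGeometryKLevelV1.c35Y
      (geo9Y (d := θ.d₆) (ℓ := θ.ℓ₆) (hd := θ.hd') (hL := θ.hL') (b₀ := θ.b₀) (b₁ := θ.b₁) (Mstar := Mstar'))
      (bg9YP (Matrix (Fin N) (Fin N) ℂ) (specialUnitaryUnits (Fin N)))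
      (fun x => siteKernelP (opsYNuStOfRecordV4PE N θ Mstar' 𝔯 𝔢st 𝔴 𝔈 x).QGQinv) (fun x => siteKernelP (opsYNuStOfRecordV4PE N θ Mstar' 𝔯 𝔢st 𝔴 𝔈 x).QG1Qinv)) :
    ∃ M₄ δ₁ a₀ C : ℝ, 0 < M₄ ∧ 0 < δ₁ ∧ 0 < a₀ ∧ 0 < C ∧
      ∀ x : MemberY θ.d₆ θ.ℓ₆ θ.hd' θ.hL' θ.b₀ θ.b₁ Mstar', M₄ ≤ (geo9Y x).M → ∀ α₀ : ℝ, 0 < α₀ → (geo9Y x).M * α₀ ≤ a₀ →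
        ∀ U : (bg9YP (Matrix (Fin N) (Fin N) ℂ) (specialUnitaryUnits (Fin N)) x).Cfg,
          (bg9YP (Matrix (Fin N) (Fin N) ℂ) (specialUnitaryUnits (Fin N)) x).Reg335 B9PinGeometryKLevelV1.c35Y α₀ U →
          (bg9YP (Matrix (Fin N) (Fin N) ℂ) (specialUnitaryUnits (Fin N)) x).Reg336 B9PinGeometryKLevelV1.c35Y α₀ U →
          ∀ u v : IBondY x.toKIdx, inΛstY x u → inΛstY x v →
            (⨆ E : BallY (Matrix (Fin N) (Fin N) ℂ),
                ‖(((((((θ.ℓ₆ + 1 : ℕ) : ℝ)) ^ x.k)⁻¹ ^ (θ.d₆ + 1) : ℝ) : ℂ) • (lettersYOfRecordV4P N θ Mstar' 𝔯 x).QG1Qinv U)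
                  (deltaY v (E : Matrix (Fin N) (Fin N) ℂ)) u‖) ≤ C * Real.exp (-(δ₁ * unitDistY x u v)) := by
  obtain ⟨M₄, δ₁, a₀, C, hM, hδ, ha, hC, H⟩ := h
  refine ⟨M₄, δ₁, a₀, C, hM, hδ, ha, hC, fun x hMx α₀ hα hMa U h35 h36 u v hu hv => ?_⟩
  have h2 : B9.Ineq3132 (θ.d₆ + 1) ((opsYNuStOfRecordV4PE N θ Mstar' 𝔯 𝔢st 𝔴 𝔈 x).QG1Qinv) C δ₁ U := (H x hMx α₀ hα hMa U h35 h36).2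
  exact pRowOnΛst_opsYNuStOfRecordV4PE_of_ineq3132 θ Mstar' 𝔯 𝔢st 𝔴 𝔈 x (θ.d₆ + 1) hC.le hδ.le U h2 hu hv

/-- ★★★ **THE SOCKET FORM — THE STAR DOORS' (3.132) P-ROW READ FROM NODE N06's LEAF OF RECORD.**  From `h06 : B9LeafX (Y9OfRecordP N θ M⋆ (opsYNuStOfRecordV4PE N θ M⋆ 𝔯 𝔢 𝔴 𝔈))`
— the N06 socket of record at NODE 00's [B9] bundle `Y9OfRecordP` (`Node00.CarriersYP`: print's class `bg9YP`, the readings of the operator layer), the hypothesis the K1 face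
of node N24 and node N07 consume and dag-n06-d's STAR-edition certificate concludes — its field `s3132` ((3.132) for `(QG̃Q*)⁻¹ ∕ (QG₁Q*)⁻¹` fed `G′_phys`, [B9] p. 422) IS
the hypothesis of `pRowOnΛst_family_opsYNuStOfRecordV4PE_P` (every carrier projection of `Y9OfRecordP` is definitional), whence the print-unit P-row on STAR pairs for
`(lettersYOfRecordV4P N θ M⋆ 𝔯 x).QG1Qinv U`, ONE pair `(C, δ₁)` for the family, under print's thresholds `M₄ ≤ M`, `Mα₀ ≤ a₀` and print's regularity (3.35)–(3.36).
[cite: Balaban1985BackgroundPropagators, (3.132) p.422, Thm 3.12 p.423, (3.35)–(3.36) p.396, (3.155) p.427; Balaban1984PropagatorsII, (2.3) p.224, (2.149) p.249; Balaban1985UV3, (24) p.262] -/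
theorem pRowOnΛst_family_of_b9LeafX_opsYNuStOfRecordV4PE
    (h06 : B9LeafX (Y9OfRecordP N θ Mstar' (opsYNuStOfRecordV4PE N θ Mstar' 𝔯 𝔢st 𝔴 𝔈))) :
    ∃ M₄ δ₁ a₀ C : ℝ, 0 < M₄ ∧ 0 < δ₁ ∧ 0 < a₀ ∧ 0 < C ∧
      ∀ x : MemberY θ.d₆ θ.ℓ₆ θ.hd' θ.hL' θ.b₀ θ.b₁ Mstar', M₄ ≤ (geo9Y x).M → ∀ α₀ : ℝ, 0 < α₀ → (geo9Y x).M * α₀ ≤ a₀ →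
        ∀ U : (bg9YP (Matrix (Fin N) (Fin N) ℂ) (specialUnitaryUnits (Fin N)) x).Cfg,
          (bg9YP (Matrix (Fin N) (Fin N) ℂ) (specialUnitaryUnits (Fin N)) x).Reg335 B9PinGeometryKLevelV1.c35Y α₀ U →
          (bg9YP (Matrix (Fin N) (Fin N) ℂ) (specialUnitaryUnits (Fin N)) x).Reg336 B9PinGeometryKLevelV1.c35Y α₀ U →
          ∀ u v : IBondY x.toKIdx, inΛstY x u → inΛstY x v →
            (⨆ E : BallY (Matrix (Fin N) (Fin N) ℂ),
                ‖(((((((θ.ℓ₆ + 1 : ℕ) : ℝ)) ^ x.k)⁻¹ ^ (θ.d₆ + 1) : ℝ) : ℂ) • (lettersYOfRecordV4P N θ Mstar' 𝔯 x).QG1Qinv U)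
                  (deltaY v (E : Matrix (Fin N) (Fin N) ℂ)) u‖) ≤ C * Real.exp (-(δ₁ * unitDistY x u v)) :=
  pRowOnΛst_family_opsYNuStOfRecordV4PE_P θ Mstar' 𝔯 𝔢st 𝔴 𝔈 h06.s3132

end PRowRecordP

/-! ## §4  The GENERAL-background star doors of record RE-KEYED to the v4P letters, and the edition MODULO node N06's socket of record -/

section DoorRecordP

open B1Eq324BenfattoClassSectEMemberRealAdjointAtNode00 (norm_trBasis_le)
open B1Eq324BenfattoClassSectEMemberPrecisionDoorAtOneStar (coercive_CsDeltaCPstY_of_ineq2153_of_units)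
open B1Eq324BenfattoClassSectEMemberERowsAtNode00Star (local_elimCΛstY_ofRecordTC colMass_elimCΛstY_ofRecordTC)
open B1Eq324BenfattoClassSectEMemberPrecisionDoorOnLambdaStar (eq324_CsDeltaCstY_precision_ofRecordTC_trBasis_onΛst_on_unit)
open B1Eq324BenfattoClassSectEMemberERowsAtNode00StarSmall (norm_inverse_KstY_apply_le_of_smallVY)

/-- ★★★ **THE (3.24) STAR DOOR OF RECORD AT THE v4P LETTERS, GENERAL `U`, DISPLAYED ROWS IN STAR CURRENCY** — seat n08-b's
`…PrecisionDoorOnLambdaStar.eq324_CsDeltaCPstY_sectEStYOfRecordV7_trBasis_of_units_onΛst_on_unit` (p702005 §4) VERBATIM with the letters of record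
`lettersYOfRecordV4 ↦ lettersYOfRecordV4P` (Sect. D composites fed `G′_phys`, the record node N06 certifies); the one record-specific input (R1′) is §1's
`lettersYOfRecordV4P_QG1Qinv_isSymmTr`, everything else (the generic door p702005 §3 at `𝔏 := lettersYOfRecordV4P … x`, `V = avYOfRecord x U`, (R3′)∕(R4′) at the
seven-letter star record, the transfer `coercive_CsDeltaCPstY_of_ineq2153_of_units`) is record-free.  Displayed per background: `G ≤ U(N)`, `G`-valued `U`, the reality
rows `IsSymmTr ((𝔯 x).Δ2 U)`, `IsSymmTr ((𝔢₀ x).D2J U)`, the (3.132) P-row for `(lettersYOfRecordV4P …).QG1Qinv U` and the 𝒥-row on STAR pairs, the three star-pivot rows,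
the Δ_k-row `γ₀` for `deltaKPstY x (lettersYOfRecordV4P …) (sectEStYOfRecordV7 …) U` on print's `V`-constrained STAR subspace.  Conclusion: (3.24) for
`𝒩(0, 𝕄_ι(CsDeltaCPstY x (lettersYOfRecordV4P N θ M⋆ 𝔯 x) (sectEStYOfRecordV7 N θ M⋆ 𝔢₀ x) U)⁻¹)` — print's `dμ_{C̃^{(k)}(U)}` of (3.157) at NODE 00's dictionary.
[cite: Balaban1985BackgroundPropagators, (3.35) p.396, (3.132) p.422, (3.155)–(3.158) pp.427–428, Thm 3.11 p.416, (3.24)–(3.25) p.394; Balaban1984PropagatorsII, (2.3) p.224,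
Lemma 2.4 p.245, (2.153)–(2.156) pp.249–250; Balaban1985UV3, (24) p.262, pp.271–272; Balaban1982Higgs1, (3.24) p.616; BenfattoEtAl1978, Lemma (4.5)–(4.7) p.152
(class form; bent window, presentation and coordinates ours)] -/
theorem eq324_CsDeltaCPstY_lettersYOfRecordV4P_sectEStYOfRecordV7_trBasis_of_units_onΛst_on_unit (N : ℕ) [NeZero N] (θ : Stage3Params) (Mstar : ℕ)
    (𝔯 : ResY N θ Mstar) (𝔢₀ : SectEY N θ Mstar) {γ₀ BP KJ δ κK : ℝ} (hγ₀ : 0 < γ₀) (hBP : 0 ≤ BP) (hKJ : 0 ≤ KJ) (hδ : 0 < δ) (hκK : 0 ≤ κK)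
    (t D : ℕ) {ϰ : ℝ} (hϰ : 0 < ϰ) {p₀ σ' c κ' : ℝ} (hp₀ : 2 / 3 < p₀) (hσ : 0 < σ') (hc : 0 ≤ c) (hκ : 0 < κ') (hκσ : κ' < σ' * (t + 1)) :
    ∃ b₁ : ℝ, ∀ b₀ : ℝ, b₁ < b₀ → ∃ C : ℝ, 0 ≤ C ∧ ∀ η : ℝ, 0 < η → η ≤ 1 →
      ∀ (x : MemberY θ.d₆ θ.ℓ₆ θ.hd' θ.hL' θ.b₀ θ.b₁ Mstar) [DecidableEq (IBondY x.toKIdx)]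
        {G : Subgroup (Matrix (Fin N) (Fin N) ℂ)ˣ}, G ≤ unitaryUnits (Matrix (Fin N) (Fin N) ℂ) →
      ∀ (U : CfgY (Matrix (Fin N) (Fin N) ℂ) x.toKIdx), (∀ μ z, U μ z ∈ G) →
        IsSymmTr (fun _ => (1 : ℝ)) ((𝔯 x).Δ2 U) → IsSymmTr (fun _ => (1 : ℝ)) ((𝔢₀ x).D2J U) →
      ∀ {σ : Type} [Fintype σ] [DecidableEq σ] [Nonempty σ] (ι : σ → IBondY x.toKIdx), Function.Injective ι → (∀ s, lamTstY x (ι s)) →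
        (∀ u v : IBondY x.toKIdx, inΛstY x u → inΛstY x v →
          (⨆ E : BallY (Matrix (Fin N) (Fin N) ℂ), ‖(((etaDY x : ℝ) : ℂ) • (lettersYOfRecordV4P N θ Mstar 𝔯 x).QG1Qinv U)
              (deltaY v (E : Matrix (Fin N) (Fin N) ℂ)) u‖) ≤ BP * Real.exp (-(δ * unitDistY x u v))) →
        (∀ (u v : IBondY x.toKIdx) (E : Matrix (Fin N) (Fin N) ℂ), inΛstY x u → inΛstY x v →
          ‖((((etaDY x : ℝ) : ℂ) • (aY x.toKIdx + (𝔢₀ x).D2J U)).restrictScalars ℝ) (Pi.single v E) u‖ ≤ KJ * ‖E‖ * Real.exp (-(δ * unitDistY x u v))) →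
        (∀ c' : CBondStY x, IsUnit (KstY x (avYOfRecord x) U c')) → (∀ c' : CBondStY x, IsUnit (KTstY x (avYOfRecord x) U c')) →
        (∀ (c' : CBondStY x) (a : Matrix (Fin N) (Fin N) ℂ),
          ‖Ring.inverse (KstY x (avYOfRecord x) U c') a‖ ≤ κK * (((θ.ℓ₆ + 1 : ℕ) : ℝ)) ^ (θ.d₆ + 1) * ‖a‖) →
        (∀ B : IBondY x.toKIdx → Matrix (Fin N) (Fin N) ℂ, (∀ q, ¬ inΛstY x q → B q = 0) → (∀ q, IsAxialY x q → B q = 0) →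
          (∀ c' : CBondStY x, Q1Y x (avYOfRecord x) U c'.1 B = 0) →
          γ₀ * trIP (fun _ => (1 : ℝ)) B B ≤
            trIP (fun _ => (1 : ℝ)) B (deltaKPstY x (lettersYOfRecordV4P N θ Mstar 𝔯 x) (sectEStYOfRecordV7 N θ Mstar 𝔢₀ x) U B)) →
      ∃ (Λ : Finset (B1Eq324BenfattoLemma.Site (θ.d₆ + 1 + (θ.d₆ + 1) + 1))) (e' : σ × TrIdx N ≃ ↥Λ),
        ((gaussianFieldOfKernel fun u w => if h : u ∈ Λ ∧ w ∈ Λ then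
            ((Matrix.reindex e' e'
              (Matrix.of fun p q : σ × TrIdx N =>
                  trReForm (trBasis N p.2) (((CsDeltaCPstY x (lettersYOfRecordV4P N θ Mstar 𝔯 x)
            (sectEStYOfRecordV7 N θ Mstar 𝔢₀ x) U).restrictScalars ℝ)
                    (Pi.single (ι q.1) (trBasis N q.2)) (ι p.1))))⁻¹ :
                Matrix ↥Λ ↥Λ ℝ) ⟨u, h.1⟩ ⟨w, h.2⟩ else 0).map
            (fun (z : B1Eq324BenfattoLemma.Site (θ.d₆ + 1 + (θ.d₆ + 1) + 1) → ℝ) (q : σ × TrIdx N) => z ((e' q : ↥Λ) : B1Eq324BenfattoLemma.Site (θ.d₆ + 1 + (θ.d₆ + 1) + 1))) =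
          gaussianFieldOfKernel fun p q =>
            ((Matrix.of fun p q : σ × TrIdx N =>
                trReForm (trBasis N p.2) (((CsDeltaCPstY x (lettersYOfRecordV4P N θ Mstar 𝔯 x)
            (sectEStYOfRecordV7 N θ Mstar 𝔢₀ x) U).restrictScalars ℝ)
                  (Pi.single (ι q.1) (trBasis N q.2)) (ι p.1)))⁻¹ :
              Matrix (σ × TrIdx N) (σ × TrIdx N) ℝ) p q) ∧
        (∀ p : ℝ, 0 ≤ p →
          ((fun (z : B1Eq324BenfattoLemma.Site (θ.d₆ + 1 + (θ.d₆ + 1) + 1) → ℝ) (q : σ × TrIdx N) => z ((e' q : ↥Λ) : B1Eq324BenfattoLemma.Site (θ.d₆ + 1 + (θ.d₆ + 1) + 1))) ⁻¹'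
              {ω : σ × TrIdx N → ℝ | ∀ q, |ω q| ≤ p}) =ᵐ[gaussianFieldOfKernel fun u w => if h : u ∈ Λ ∧ w ∈ Λ then
                ((Matrix.reindex e' e'
                  (Matrix.of fun p q : σ × TrIdx N =>
                      trReForm (trBasis N p.2) (((CsDeltaCPstY x (lettersYOfRecordV4P N θ Mstar 𝔯 x)
            (sectEStYOfRecordV7 N θ Mstar 𝔢₀ x) U).restrictScalars ℝ)
                        (Pi.single (ι q.1) (trBasis N q.2)) (ι p.1))))⁻¹ :
                    Matrix ↥Λ ↥Λ ℝ) ⟨u, h.1⟩ ⟨w, h.2⟩ else 0]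
            smallFieldSet Λ p) ∧
        ∀ (s : ℕ) (I J : Finset (B1Eq324BenfattoLemma.Site (θ.d₆ + 1 + (θ.d₆ + 1) + 1))) (𝔞 : Coef (θ.d₆ + 1 + (θ.d₆ + 1) + 1)),
          I.Nonempty → J ⊆ I → J ⊆ Λ → coefSup s D 𝔞 J ≤ c * η ^ σ' →
          0 < ∫ z, cutoffBoltzmann (hamiltonian s D ϰ 𝔞 J) I (B10.pFun b₀ p₀ η) z ∂(gaussianFieldOfKernel fun u w => if h : u ∈ Λ ∧ w ∈ Λ then
              ((Matrix.reindex e' e'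
                (Matrix.of fun p q : σ × TrIdx N =>
                    trReForm (trBasis N p.2) (((CsDeltaCPstY x (lettersYOfRecordV4P N θ Mstar 𝔯 x)
            (sectEStYOfRecordV7 N θ Mstar 𝔢₀ x) U).restrictScalars ℝ)
                      (Pi.single (ι q.1) (trBasis N q.2)) (ι p.1))))⁻¹ :
                  Matrix ↥Λ ↥Λ ℝ) ⟨u, h.1⟩ ⟨w, h.2⟩ else 0) ∧
            |Real.log (∫ z, cutoffBoltzmann (hamiltonian s D ϰ 𝔞 J) I (B10.pFun b₀ p₀ η) z ∂(gaussianFieldOfKernel fun u w =>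
                if h : u ∈ Λ ∧ w ∈ Λ then
                  ((Matrix.reindex e' e'
                    (Matrix.of fun p q : σ × TrIdx N =>
                        trReForm (trBasis N p.2) (((CsDeltaCPstY x (lettersYOfRecordV4P N θ Mstar 𝔯 x)
            (sectEStYOfRecordV7 N θ Mstar 𝔢₀ x) U).restrictScalars ℝ)
                          (Pi.single (ι q.1) (trBasis N q.2)) (ι p.1))))⁻¹ :
                      Matrix ↥Λ ↥Λ ℝ) ⟨u, h.1⟩ ⟨w, h.2⟩ else 0)) -
              cumulantSum (gaussianFieldOfKernel fun u w => if h : u ∈ Λ ∧ w ∈ Λ then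
                  ((Matrix.reindex e' e'
                    (Matrix.of fun p q : σ × TrIdx N =>
                        trReForm (trBasis N p.2) (((CsDeltaCPstY x (lettersYOfRecordV4P N θ Mstar 𝔯 x)
            (sectEStYOfRecordV7 N θ Mstar 𝔢₀ x) U).restrictScalars ℝ)
                          (Pi.single (ι q.1) (trBasis N q.2)) (ι p.1))))⁻¹ :
                      Matrix ↥Λ ↥Λ ℝ) ⟨u, h.1⟩ ⟨w, h.2⟩ else 0)
                (hamiltonian s D ϰ 𝔞 J) t| ≤ C * η ^ κ' * I.card := by
  have hm : (0 : ℝ) ≤ (1 + κK) * 1 := by positivity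
  obtain ⟨b₁, hb₁⟩ := eq324_CsDeltaCstY_precision_ofRecordTC_trBasis_onΛst_on_unit (d := θ.d₆) N hγ₀ hBP hKJ hδ hm t D hϰ hp₀ hσ hc hκ hκσ
    (r := (θ.ℓ₆ : ℝ) + 2)
  refine ⟨b₁, fun b₀ hb₀ => ?_⟩
  obtain ⟨C, hC, hE⟩ := hb₁ b₀ hb₀
  refine ⟨C, hC, ?_⟩
  intro η hη hηle x _ G hG U hU hΔ2 hD2J σ _ _ _ ι hι hιT hProw hJker hK hKT hKinv hco
  have h𝔳 : ∀ b : UBondY x, ((avYOfRecord x U b : (Matrix (Fin N) (Fin N) ℂ)ˣ) : Matrix (Fin N) (Fin N) ℂ) ∈ unitary (Matrix (Fin N) (Fin N) ℂ) :=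
    fun b => B7Prop2Explicit.mem_unitaryUnits.mp (hG (avYOfRecord_mem x hU b))
  exact hE η hη hηle x (lettersYOfRecordV4P N θ Mstar 𝔯 x) (avYOfRecord x) (𝔢₀ x) U (etaDY x) ι hι hιT
    (lettersYOfRecordV4P_QG1Qinv_isSymmTr θ Mstar 𝔯 hG x hU hΔ2) hD2J hProw hJker h𝔳 hK hKT
    (local_elimCΛstY_ofRecordTC x (avYOfRecord x) (𝔢₀ x) U ι)
    (colMass_elimCΛstY_ofRecordTC x (avYOfRecord x) (𝔢₀ x) (norm_coe_le_one_of_le_unitaryUnits hG) (fun b => avYOfRecord_mem x hU b) hκK hKinv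
      (fun c' => trBasis N c') norm_trBasis_le ι)
    (fun Φ hΦ => coercive_CsDeltaCPstY_of_ineq2153_of_units x (avYOfRecord x) (lettersYOfRecordV4P N θ Mstar 𝔯 x) (𝔢₀ x) h𝔳 hK hKT hγ₀.le hco Φ
      fun q hq => hΦ q fun hq' => hq (by obtain ⟨s, rfl⟩ := hq'; exact hιT s))


/-- ★★★ **THE STAR DOOR OF RECORD AT THE v4P LETTERS, GENERAL SMALL BACKGROUND** — seat n08-b's `…PrecisionDoorOnLambdaStarSmall` §1 (p704589) VERBATIM over
the v4P door above: the three star-pivot rows DISCHARGED by the small averaged field of record (`‖V(b) − 1‖ ≤ δ_V`, `L^{d+1}·2δ_V(L + (d+1)ℓ) < 1`; seat n08-d's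
`isUnit_K[T]stY_of_smallVY`, `norm_inverse_KstY_apply_le_of_smallVY`, record-free).
[cite: Balaban1985BackgroundPropagators, (3.35) p.396, (3.132) p.422, (3.155)–(3.158) pp.427–428, Thm 3.11 p.416; Balaban1985Averaging, (125)–(126) p.36;
Balaban1984PropagatorsII, (2.3) p.224, Lemma 2.4 p.245, (2.153)–(2.156) pp.249–250; Balaban1985UV3, (24) p.262, pp.271–272; Balaban1982Higgs1, (3.24) p.616;
BenfattoEtAl1978, Lemma (4.5)–(4.7) p.152 (class form; bent window, presentation and coordinates ours)] -/
theorem eq324_CsDeltaCPstY_lettersYOfRecordV4P_sectEStYOfRecordV7_trBasis_of_small_onΛst_on_unit (N : ℕ) [NeZero N] (θ : Stage3Params) (Mstar : ℕ)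
    (𝔯 : ResY N θ Mstar) (𝔢₀ : SectEY N θ Mstar) {γ₀ BP KJ δ δV : ℝ} (hγ₀ : 0 < γ₀) (hBP : 0 ≤ BP) (hKJ : 0 ≤ KJ) (hδ : 0 < δ) (hδV : 0 ≤ δV)
    (hsmall : (((θ.ℓ₆ + 1 : ℕ) : ℝ)) ^ (θ.d₆ + 1) * (2 * δV * (((θ.ℓ₆ + 1 : ℕ) + (θ.d₆ + 1) * θ.ℓ₆ : ℕ) : ℝ)) < 1)
    (t D : ℕ) {ϰ : ℝ} (hϰ : 0 < ϰ) {p₀ σ' c κ' : ℝ} (hp₀ : 2 / 3 < p₀) (hσ : 0 < σ') (hc : 0 ≤ c) (hκ : 0 < κ') (hκσ : κ' < σ' * (t + 1)) :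
    ∃ b₁ : ℝ, ∀ b₀ : ℝ, b₁ < b₀ → ∃ C : ℝ, 0 ≤ C ∧ ∀ η : ℝ, 0 < η → η ≤ 1 →
      ∀ (x : MemberY θ.d₆ θ.ℓ₆ θ.hd' θ.hL' θ.b₀ θ.b₁ Mstar) [DecidableEq (IBondY x.toKIdx)]
        {G : Subgroup (Matrix (Fin N) (Fin N) ℂ)ˣ}, G ≤ unitaryUnits (Matrix (Fin N) (Fin N) ℂ) →
      ∀ (U : CfgY (Matrix (Fin N) (Fin N) ℂ) x.toKIdx), (∀ μ z, U μ z ∈ G) →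
        (∀ b : UBondY x, ‖((avYOfRecord x U b : (Matrix (Fin N) (Fin N) ℂ)ˣ) : Matrix (Fin N) (Fin N) ℂ) - 1‖ ≤ δV) →
        IsSymmTr (fun _ => (1 : ℝ)) ((𝔯 x).Δ2 U) → IsSymmTr (fun _ => (1 : ℝ)) ((𝔢₀ x).D2J U) →
      ∀ {σ : Type} [Fintype σ] [DecidableEq σ] [Nonempty σ] (ι : σ → IBondY x.toKIdx), Function.Injective ι → (∀ s, lamTstY x (ι s)) →
        (∀ u v : IBondY x.toKIdx, inΛstY x u → inΛstY x v →
          (⨆ E : BallY (Matrix (Fin N) (Fin N) ℂ), ‖(((etaDY x : ℝ) : ℂ) • (lettersYOfRecordV4P N θ Mstar 𝔯 x).QG1Qinv U)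
              (deltaY v (E : Matrix (Fin N) (Fin N) ℂ)) u‖) ≤ BP * Real.exp (-(δ * unitDistY x u v))) →
        (∀ (u v : IBondY x.toKIdx) (E : Matrix (Fin N) (Fin N) ℂ), inΛstY x u → inΛstY x v →
          ‖((((etaDY x : ℝ) : ℂ) • (aY x.toKIdx + (𝔢₀ x).D2J U)).restrictScalars ℝ) (Pi.single v E) u‖ ≤ KJ * ‖E‖ * Real.exp (-(δ * unitDistY x u v))) →
        (∀ B : IBondY x.toKIdx → Matrix (Fin N) (Fin N) ℂ, (∀ q, ¬ inΛstY x q → B q = 0) → (∀ q, IsAxialY x q → B q = 0) →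
          (∀ c' : CBondStY x, Q1Y x (avYOfRecord x) U c'.1 B = 0) →
          γ₀ * trIP (fun _ => (1 : ℝ)) B B ≤
            trIP (fun _ => (1 : ℝ)) B (deltaKPstY x (lettersYOfRecordV4P N θ Mstar 𝔯 x) (sectEStYOfRecordV7 N θ Mstar 𝔢₀ x) U B)) →
      ∃ (Λ : Finset (B1Eq324BenfattoLemma.Site (θ.d₆ + 1 + (θ.d₆ + 1) + 1))) (e' : σ × TrIdx N ≃ ↥Λ),
        ((gaussianFieldOfKernel fun u w => if h : u ∈ Λ ∧ w ∈ Λ then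
            ((Matrix.reindex e' e'
              (Matrix.of fun p q : σ × TrIdx N =>
                  trReForm (trBasis N p.2) (((CsDeltaCPstY x (lettersYOfRecordV4P N θ Mstar 𝔯 x)
            (sectEStYOfRecordV7 N θ Mstar 𝔢₀ x) U).restrictScalars ℝ)
                    (Pi.single (ι q.1) (trBasis N q.2)) (ι p.1))))⁻¹ :
                Matrix ↥Λ ↥Λ ℝ) ⟨u, h.1⟩ ⟨w, h.2⟩ else 0).map
            (fun (z : B1Eq324BenfattoLemma.Site (θ.d₆ + 1 + (θ.d₆ + 1) + 1) → ℝ) (q : σ × TrIdx N) => z ((e' q : ↥Λ) : B1Eq324BenfattoLemma.Site (θ.d₆ + 1 + (θ.d₆ + 1) + 1))) =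
          gaussianFieldOfKernel fun p q =>
            ((Matrix.of fun p q : σ × TrIdx N =>
                trReForm (trBasis N p.2) (((CsDeltaCPstY x (lettersYOfRecordV4P N θ Mstar 𝔯 x)
            (sectEStYOfRecordV7 N θ Mstar 𝔢₀ x) U).restrictScalars ℝ)
                  (Pi.single (ι q.1) (trBasis N q.2)) (ι p.1)))⁻¹ :
              Matrix (σ × TrIdx N) (σ × TrIdx N) ℝ) p q) ∧
        (∀ p : ℝ, 0 ≤ p →
          ((fun (z : B1Eq324BenfattoLemma.Site (θ.d₆ + 1 + (θ.d₆ + 1) + 1) → ℝ) (q : σ × TrIdx N) => z ((e' q : ↥Λ) : B1Eq324BenfattoLemma.Site (θ.d₆ + 1 + (θ.d₆ + 1) + 1))) ⁻¹'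
              {ω : σ × TrIdx N → ℝ | ∀ q, |ω q| ≤ p}) =ᵐ[gaussianFieldOfKernel fun u w => if h : u ∈ Λ ∧ w ∈ Λ then
                ((Matrix.reindex e' e'
                  (Matrix.of fun p q : σ × TrIdx N =>
                      trReForm (trBasis N p.2) (((CsDeltaCPstY x (lettersYOfRecordV4P N θ Mstar 𝔯 x)
            (sectEStYOfRecordV7 N θ Mstar 𝔢₀ x) U).restrictScalars ℝ)
                        (Pi.single (ι q.1) (trBasis N q.2)) (ι p.1))))⁻¹ :
                    Matrix ↥Λ ↥Λ ℝ) ⟨u, h.1⟩ ⟨w, h.2⟩ else 0]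
            smallFieldSet Λ p) ∧
        ∀ (s : ℕ) (I J : Finset (B1Eq324BenfattoLemma.Site (θ.d₆ + 1 + (θ.d₆ + 1) + 1))) (𝔞 : Coef (θ.d₆ + 1 + (θ.d₆ + 1) + 1)),
          I.Nonempty → J ⊆ I → J ⊆ Λ → coefSup s D 𝔞 J ≤ c * η ^ σ' →
          0 < ∫ z, cutoffBoltzmann (hamiltonian s D ϰ 𝔞 J) I (B10.pFun b₀ p₀ η) z ∂(gaussianFieldOfKernel fun u w => if h : u ∈ Λ ∧ w ∈ Λ then
              ((Matrix.reindex e' e'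
                (Matrix.of fun p q : σ × TrIdx N =>
                    trReForm (trBasis N p.2) (((CsDeltaCPstY x (lettersYOfRecordV4P N θ Mstar 𝔯 x)
            (sectEStYOfRecordV7 N θ Mstar 𝔢₀ x) U).restrictScalars ℝ)
                      (Pi.single (ι q.1) (trBasis N q.2)) (ι p.1))))⁻¹ :
                  Matrix ↥Λ ↥Λ ℝ) ⟨u, h.1⟩ ⟨w, h.2⟩ else 0) ∧
            |Real.log (∫ z, cutoffBoltzmann (hamiltonian s D ϰ 𝔞 J) I (B10.pFun b₀ p₀ η) z ∂(gaussianFieldOfKernel fun u w =>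
                if h : u ∈ Λ ∧ w ∈ Λ then
                  ((Matrix.reindex e' e'
                    (Matrix.of fun p q : σ × TrIdx N =>
                        trReForm (trBasis N p.2) (((CsDeltaCPstY x (lettersYOfRecordV4P N θ Mstar 𝔯 x)
            (sectEStYOfRecordV7 N θ Mstar 𝔢₀ x) U).restrictScalars ℝ)
                          (Pi.single (ι q.1) (trBasis N q.2)) (ι p.1))))⁻¹ :
                      Matrix ↥Λ ↥Λ ℝ) ⟨u, h.1⟩ ⟨w, h.2⟩ else 0)) -
              cumulantSum (gaussianFieldOfKernel fun u w => if h : u ∈ Λ ∧ w ∈ Λ then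
                  ((Matrix.reindex e' e'
                    (Matrix.of fun p q : σ × TrIdx N =>
                        trReForm (trBasis N p.2) (((CsDeltaCPstY x (lettersYOfRecordV4P N θ Mstar 𝔯 x)
            (sectEStYOfRecordV7 N θ Mstar 𝔢₀ x) U).restrictScalars ℝ)
                          (Pi.single (ι q.1) (trBasis N q.2)) (ι p.1))))⁻¹ :
                      Matrix ↥Λ ↥Λ ℝ) ⟨u, h.1⟩ ⟨w, h.2⟩ else 0)
                (hamiltonian s D ϰ 𝔞 J) t| ≤ C * η ^ κ' * I.card := by
  -- `κ_K := (1 − κ)⁻¹ ≥ 0` from the smallness numeral; then §4 of p702005 with n08-d's three small-field rows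
  have hκK : (0 : ℝ) ≤ (1 - (((θ.ℓ₆ + 1 : ℕ) : ℝ)) ^ (θ.d₆ + 1) * (2 * δV * (((θ.ℓ₆ + 1 : ℕ) + (θ.d₆ + 1) * θ.ℓ₆ : ℕ) : ℝ)))⁻¹ :=
    inv_nonneg.2 (sub_nonneg.2 hsmall.le)
  obtain ⟨b₁, hb₁⟩ := eq324_CsDeltaCPstY_lettersYOfRecordV4P_sectEStYOfRecordV7_trBasis_of_units_onΛst_on_unit N θ Mstar 𝔯 𝔢₀ hγ₀ hBP hKJ hδ hκK t D hϰ
    hp₀ hσ hc hκ hκσ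
  refine ⟨b₁, fun b₀ hb₀ => ?_⟩
  obtain ⟨C, hC, hE⟩ := hb₁ b₀ hb₀
  refine ⟨C, hC, ?_⟩
  intro η hη hηle x _ G hG U hU hV hΔ2 hD2J σ _ _ _ ι hι hιT hProw hJker hco
  have hsm : SmallVY x (avYOfRecord x) G U δV := smallVY_avYOfRecord N θ Mstar x hG hU hδV hV hsmall
  exact hE η hη hηle x hG U hU hΔ2 hD2J ι hι hιT hProw hJker (isUnit_KstY_of_smallVY x _ hsm) (isUnit_KTstY_of_smallVY x _ hsm)
    (norm_inverse_KstY_apply_le_of_smallVY x _ hsm) hco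


/-- ★★★ **… WITH THE P-ROW BY NAME, PER BACKGROUND, AT THE RECORD NODE N06 CERTIFIES**: §4's small-field door with the displayed (R2′a) on STAR pairs REPLACED by
[B9] (3.132) for the `ν`-read row-26 field of def-Y's STAR v4P record, `B9.Ineq3132 (d+1) ((opsYNuStOfRecordV4PE N θ M⋆ 𝔯 𝔢st 𝔴 𝔈 x).QG1Qinv) B_P δ U` (any star Sect.-E ∕
walk ∕ exponent families — the field does not see them; it is LITERALLY `(opsYNuOfRecordV4PE …).QG1Qinv` too, both `siteKernelOfOpNu … (QG1QinvY … (GpPhysY …) …)` by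
def-Y's `rfl` faces), read on STAR pairs by §3's `pRowOnΛst_opsYNuStOfRecordV4PE_of_ineq3132`.
[cite: Balaban1985BackgroundPropagators, (3.132) p.422, Thm 3.12 p.423, (3.35) p.396, (3.155)–(3.158) pp.427–428; Balaban1984PropagatorsII, (2.149) p.249, (2.3) p.224,
Lemma 2.4 p.245; Balaban1985Averaging, (125)–(126) p.36; Balaban1985UV3, (24) p.262, pp.271–272; Balaban1982Higgs1, (3.24) p.616; BenfattoEtAl1978, Lemma (4.5)–(4.7)
p.152 (class form; bent window, presentation and coordinates ours)] -/
theorem eq324_CsDeltaCPstY_lettersYOfRecordV4P_sectEStYOfRecordV7_trBasis_of_ineq3132_of_small_onΛst_on_unit (N : ℕ) [NeZero N] (θ : Stage3Params) (Mstar : ℕ)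
    (𝔯 : ResY N θ Mstar) (𝔢₀ : SectEY N θ Mstar) (𝔢st : SectEStY N θ Mstar) (𝔴 : RWEY N θ Mstar) (𝔈 : ExpsY N θ Mstar) {γ₀ BP KJ δ δV : ℝ} (hγ₀ : 0 < γ₀) (hBP : 0 ≤ BP)
    (hKJ : 0 ≤ KJ) (hδ : 0 < δ) (hδV : 0 ≤ δV)
    (hsmall : (((θ.ℓ₆ + 1 : ℕ) : ℝ)) ^ (θ.d₆ + 1) * (2 * δV * (((θ.ℓ₆ + 1 : ℕ) + (θ.d₆ + 1) * θ.ℓ₆ : ℕ) : ℝ)) < 1)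
    (t D : ℕ) {ϰ : ℝ} (hϰ : 0 < ϰ) {p₀ σ' c κ' : ℝ} (hp₀ : 2 / 3 < p₀) (hσ : 0 < σ') (hc : 0 ≤ c) (hκ : 0 < κ') (hκσ : κ' < σ' * (t + 1)) :
    ∃ b₁ : ℝ, ∀ b₀ : ℝ, b₁ < b₀ → ∃ C : ℝ, 0 ≤ C ∧ ∀ η : ℝ, 0 < η → η ≤ 1 →
      ∀ (x : MemberY θ.d₆ θ.ℓ₆ θ.hd' θ.hL' θ.b₀ θ.b₁ Mstar) [DecidableEq (IBondY x.toKIdx)]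
        {G : Subgroup (Matrix (Fin N) (Fin N) ℂ)ˣ}, G ≤ unitaryUnits (Matrix (Fin N) (Fin N) ℂ) →
      ∀ (U : CfgY (Matrix (Fin N) (Fin N) ℂ) x.toKIdx), (∀ μ z, U μ z ∈ G) →
        (∀ b : UBondY x, ‖((avYOfRecord x U b : (Matrix (Fin N) (Fin N) ℂ)ˣ) : Matrix (Fin N) (Fin N) ℂ) - 1‖ ≤ δV) →
        IsSymmTr (fun _ => (1 : ℝ)) ((𝔯 x).Δ2 U) → IsSymmTr (fun _ => (1 : ℝ)) ((𝔢₀ x).D2J U) →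
      ∀ {σ : Type} [Fintype σ] [DecidableEq σ] [Nonempty σ] (ι : σ → IBondY x.toKIdx), Function.Injective ι → (∀ s, lamTstY x (ι s)) →
        B9.Ineq3132 (θ.d₆ + 1) (opsYNuStOfRecordV4PE N θ Mstar 𝔯 𝔢st 𝔴 𝔈 x).QG1Qinv BP δ U →
        (∀ (u v : IBondY x.toKIdx) (E : Matrix (Fin N) (Fin N) ℂ), inΛstY x u → inΛstY x v →
          ‖((((etaDY x : ℝ) : ℂ) • (aY x.toKIdx + (𝔢₀ x).D2J U)).restrictScalars ℝ) (Pi.single v E) u‖ ≤ KJ * ‖E‖ * Real.exp (-(δ * unitDistY x u v))) →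
        (∀ B : IBondY x.toKIdx → Matrix (Fin N) (Fin N) ℂ, (∀ q, ¬ inΛstY x q → B q = 0) → (∀ q, IsAxialY x q → B q = 0) →
          (∀ c' : CBondStY x, Q1Y x (avYOfRecord x) U c'.1 B = 0) →
          γ₀ * trIP (fun _ => (1 : ℝ)) B B ≤
            trIP (fun _ => (1 : ℝ)) B (deltaKPstY x (lettersYOfRecordV4P N θ Mstar 𝔯 x) (sectEStYOfRecordV7 N θ Mstar 𝔢₀ x) U B)) →
      ∃ (Λ : Finset (B1Eq324BenfattoLemma.Site (θ.d₆ + 1 + (θ.d₆ + 1) + 1))) (e' : σ × TrIdx N ≃ ↥Λ),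
        ((gaussianFieldOfKernel fun u w => if h : u ∈ Λ ∧ w ∈ Λ then
            ((Matrix.reindex e' e'
              (Matrix.of fun p q : σ × TrIdx N =>
                  trReForm (trBasis N p.2) (((CsDeltaCPstY x (lettersYOfRecordV4P N θ Mstar 𝔯 x)
            (sectEStYOfRecordV7 N θ Mstar 𝔢₀ x) U).restrictScalars ℝ)
                    (Pi.single (ι q.1) (trBasis N q.2)) (ι p.1))))⁻¹ :
                Matrix ↥Λ ↥Λ ℝ) ⟨u, h.1⟩ ⟨w, h.2⟩ else 0).map
            (fun (z : B1Eq324BenfattoLemma.Site (θ.d₆ + 1 + (θ.d₆ + 1) + 1) → ℝ) (q : σ × TrIdx N) => z ((e' q : ↥Λ) : B1Eq324BenfattoLemma.Site (θ.d₆ + 1 + (θ.d₆ + 1) + 1))) =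
          gaussianFieldOfKernel fun p q =>
            ((Matrix.of fun p q : σ × TrIdx N =>
                trReForm (trBasis N p.2) (((CsDeltaCPstY x (lettersYOfRecordV4P N θ Mstar 𝔯 x)
            (sectEStYOfRecordV7 N θ Mstar 𝔢₀ x) U).restrictScalars ℝ)
                  (Pi.single (ι q.1) (trBasis N q.2)) (ι p.1)))⁻¹ :
              Matrix (σ × TrIdx N) (σ × TrIdx N) ℝ) p q) ∧
        (∀ p : ℝ, 0 ≤ p →
          ((fun (z : B1Eq324BenfattoLemma.Site (θ.d₆ + 1 + (θ.d₆ + 1) + 1) → ℝ) (q : σ × TrIdx N) => z ((e' q : ↥Λ) : B1Eq324BenfattoLemma.Site (θ.d₆ + 1 + (θ.d₆ + 1) + 1))) ⁻¹'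
              {ω : σ × TrIdx N → ℝ | ∀ q, |ω q| ≤ p}) =ᵐ[gaussianFieldOfKernel fun u w => if h : u ∈ Λ ∧ w ∈ Λ then
                ((Matrix.reindex e' e'
                  (Matrix.of fun p q : σ × TrIdx N =>
                      trReForm (trBasis N p.2) (((CsDeltaCPstY x (lettersYOfRecordV4P N θ Mstar 𝔯 x)
            (sectEStYOfRecordV7 N θ Mstar 𝔢₀ x) U).restrictScalars ℝ)
                        (Pi.single (ι q.1) (trBasis N q.2)) (ι p.1))))⁻¹ :
                    Matrix ↥Λ ↥Λ ℝ) ⟨u, h.1⟩ ⟨w, h.2⟩ else 0]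
            smallFieldSet Λ p) ∧
        ∀ (s : ℕ) (I J : Finset (B1Eq324BenfattoLemma.Site (θ.d₆ + 1 + (θ.d₆ + 1) + 1))) (𝔞 : Coef (θ.d₆ + 1 + (θ.d₆ + 1) + 1)),
          I.Nonempty → J ⊆ I → J ⊆ Λ → coefSup s D 𝔞 J ≤ c * η ^ σ' →
          0 < ∫ z, cutoffBoltzmann (hamiltonian s D ϰ 𝔞 J) I (B10.pFun b₀ p₀ η) z ∂(gaussianFieldOfKernel fun u w => if h : u ∈ Λ ∧ w ∈ Λ then
              ((Matrix.reindex e' e'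
                (Matrix.of fun p q : σ × TrIdx N =>
                    trReForm (trBasis N p.2) (((CsDeltaCPstY x (lettersYOfRecordV4P N θ Mstar 𝔯 x)
            (sectEStYOfRecordV7 N θ Mstar 𝔢₀ x) U).restrictScalars ℝ)
                      (Pi.single (ι q.1) (trBasis N q.2)) (ι p.1))))⁻¹ :
                  Matrix ↥Λ ↥Λ ℝ) ⟨u, h.1⟩ ⟨w, h.2⟩ else 0) ∧
            |Real.log (∫ z, cutoffBoltzmann (hamiltonian s D ϰ 𝔞 J) I (B10.pFun b₀ p₀ η) z ∂(gaussianFieldOfKernel fun u w =>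
                if h : u ∈ Λ ∧ w ∈ Λ then
                  ((Matrix.reindex e' e'
                    (Matrix.of fun p q : σ × TrIdx N =>
                        trReForm (trBasis N p.2) (((CsDeltaCPstY x (lettersYOfRecordV4P N θ Mstar 𝔯 x)
            (sectEStYOfRecordV7 N θ Mstar 𝔢₀ x) U).restrictScalars ℝ)
                          (Pi.single (ι q.1) (trBasis N q.2)) (ι p.1))))⁻¹ :
                      Matrix ↥Λ ↥Λ ℝ) ⟨u, h.1⟩ ⟨w, h.2⟩ else 0)) -
              cumulantSum (gaussianFieldOfKernel fun u w => if h : u ∈ Λ ∧ w ∈ Λ then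
                  ((Matrix.reindex e' e'
                    (Matrix.of fun p q : σ × TrIdx N =>
                        trReForm (trBasis N p.2) (((CsDeltaCPstY x (lettersYOfRecordV4P N θ Mstar 𝔯 x)
            (sectEStYOfRecordV7 N θ Mstar 𝔢₀ x) U).restrictScalars ℝ)
                          (Pi.single (ι q.1) (trBasis N q.2)) (ι p.1))))⁻¹ :
                      Matrix ↥Λ ↥Λ ℝ) ⟨u, h.1⟩ ⟨w, h.2⟩ else 0)
                (hamiltonian s D ϰ 𝔞 J) t| ≤ C * η ^ κ' * I.card := by
  obtain ⟨b₁, hb₁⟩ := eq324_CsDeltaCPstY_lettersYOfRecordV4P_sectEStYOfRecordV7_trBasis_of_small_onΛst_on_unit N θ Mstar 𝔯 𝔢₀ hγ₀ hBP hKJ hδ hδV hsmall t D hϰ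
    hp₀ hσ hc hκ hκσ
  refine ⟨b₁, fun b₀ hb₀ => ?_⟩
  obtain ⟨C, hC, hE⟩ := hb₁ b₀ hb₀
  refine ⟨C, hC, ?_⟩
  intro η hη hηle x _ G hG U hU hV hΔ2 hD2J σ _ _ _ ι hι hιT h3132 hJker hco
  exact hE η hη hηle x hG U hU hV hΔ2 hD2J ι hι hιT
    (fun u v hu hv => pRowOnΛst_opsYNuStOfRecordV4PE_of_ineq3132 θ Mstar 𝔯 𝔢st 𝔴 𝔈 x (θ.d₆ + 1) hBP hδ.le U h3132 hu hv) hJker hco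


/-- ★★★ **FAMILY FORM AT PRINT's CLASS `bg9YP`**: §4's P-row-by-name door under the (3.132) CLAIM `B9.Stmt3132Printed (d+1) c35 geo9Y (bg9YP SU(N))
(siteKernelP ∘ (opsYNuStOfRecordV4PE …).QGQinv) (siteKernelP ∘ ….QG1Qinv)` — character for character the field `s3132` of node N06's leaf `B9LeafX (Y9OfRecordP N θ M⋆
(opsYNuStOfRecordV4PE …))` at `c35 := c35Y` (`Node00.CarriersYP`, `B9PinCarriersKLevelV1P.carriersYP`); print's thresholds `M₄`, `a₀` and ONE rate `δ` for the whole family;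
regime print's (3.35)–(3.36) at print's cube class (`U` is `SU(N)`-valued by `mem_of_reg335P`) + the small averaged field.
[cite: Balaban1985BackgroundPropagators, (3.132) p.422, Thm 3.12 p.423, (3.35)–(3.36) p.396, (3.155)–(3.158) pp.427–428; Balaban1984PropagatorsII, (2.149) p.249,
(2.3) p.224, Lemma 2.4 p.245; Balaban1985Averaging, (125)–(126) p.36; Balaban1985UV3, (24) p.262, pp.271–272; Balaban1982Higgs1, (3.24) p.616; BenfattoEtAl1978, Lemma
(4.5)–(4.7) p.152 (class form; bent window, presentation and coordinates ours)] -/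
theorem eq324_CsDeltaCPstY_lettersYOfRecordV4P_sectEStYOfRecordV7_trBasis_of_stmt3132Printed_P_of_small_onΛst_on_unit (N : ℕ) [NeZero N] (θ : Stage3Params) (Mstar : ℕ)
    (𝔯 : ResY N θ Mstar) (𝔢₀ : SectEY N θ Mstar) (𝔢st : SectEStY N θ Mstar) (𝔴 : RWEY N θ Mstar) (𝔈 : ExpsY N θ Mstar) {c35 : ℝ}
    (h26 : B9.Stmt3132Printed (θ.d₆ + 1) c35
      (geo9Y (d := θ.d₆) (ℓ := θ.ℓ₆) (hd := θ.hd') (hL := θ.hL') (b₀ := θ.b₀) (b₁ := θ.b₁) (Mstar := Mstar))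
      (bg9YP (Matrix (Fin N) (Fin N) ℂ) (specialUnitaryUnits (Fin N)))
      (fun x => siteKernelP (opsYNuStOfRecordV4PE N θ Mstar 𝔯 𝔢st 𝔴 𝔈 x).QGQinv)
      (fun x => siteKernelP (opsYNuStOfRecordV4PE N θ Mstar 𝔯 𝔢st 𝔴 𝔈 x).QG1Qinv))
    {γ₀ KJ δV : ℝ} (hγ₀ : 0 < γ₀) (hKJ : 0 ≤ KJ) (hδV : 0 ≤ δV)
    (hsmall : (((θ.ℓ₆ + 1 : ℕ) : ℝ)) ^ (θ.d₆ + 1) * (2 * δV * (((θ.ℓ₆ + 1 : ℕ) + (θ.d₆ + 1) * θ.ℓ₆ : ℕ) : ℝ)) < 1)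
    (t D : ℕ) {ϰ : ℝ} (hϰ : 0 < ϰ) {p₀ σ' c κ' : ℝ} (hp₀ : 2 / 3 < p₀) (hσ : 0 < σ') (hc : 0 ≤ c) (hκ : 0 < κ') (hκσ : κ' < σ' * (t + 1)) :
    ∃ M₄ δ a₀ : ℝ, 0 < M₄ ∧ 0 < δ ∧ 0 < a₀ ∧ ∃ b₁ : ℝ, ∀ b₀ : ℝ, b₁ < b₀ → ∃ C : ℝ, 0 ≤ C ∧ ∀ η : ℝ, 0 < η → η ≤ 1 →
      ∀ (x : MemberY θ.d₆ θ.ℓ₆ θ.hd' θ.hL' θ.b₀ θ.b₁ Mstar) [DecidableEq (IBondY x.toKIdx)], M₄ ≤ (geo9Y x).M →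
      ∀ α₀ : ℝ, 0 < α₀ → (geo9Y x).M * α₀ ≤ a₀ →
      ∀ (U : CfgY (Matrix (Fin N) (Fin N) ℂ) x.toKIdx),
        (bg9YP (Matrix (Fin N) (Fin N) ℂ) (specialUnitaryUnits (Fin N)) x).Reg335 c35 α₀ U →
        (bg9YP (Matrix (Fin N) (Fin N) ℂ) (specialUnitaryUnits (Fin N)) x).Reg336 c35 α₀ U →
        (∀ b : UBondY x, ‖((avYOfRecord x U b : (Matrix (Fin N) (Fin N) ℂ)ˣ) : Matrix (Fin N) (Fin N) ℂ) - 1‖ ≤ δV) →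
        IsSymmTr (fun _ => (1 : ℝ)) ((𝔯 x).Δ2 U) → IsSymmTr (fun _ => (1 : ℝ)) ((𝔢₀ x).D2J U) →
      ∀ {σ : Type} [Fintype σ] [DecidableEq σ] [Nonempty σ] (ι : σ → IBondY x.toKIdx), Function.Injective ι → (∀ s, lamTstY x (ι s)) →
        (∀ (u v : IBondY x.toKIdx) (E : Matrix (Fin N) (Fin N) ℂ), inΛstY x u → inΛstY x v →
          ‖((((etaDY x : ℝ) : ℂ) • (aY x.toKIdx + (𝔢₀ x).D2J U)).restrictScalars ℝ) (Pi.single v E) u‖ ≤ KJ * ‖E‖ * Real.exp (-(δ * unitDistY x u v))) →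
        (∀ B : IBondY x.toKIdx → Matrix (Fin N) (Fin N) ℂ, (∀ q, ¬ inΛstY x q → B q = 0) → (∀ q, IsAxialY x q → B q = 0) →
          (∀ c' : CBondStY x, Q1Y x (avYOfRecord x) U c'.1 B = 0) →
          γ₀ * trIP (fun _ => (1 : ℝ)) B B ≤
            trIP (fun _ => (1 : ℝ)) B (deltaKPstY x (lettersYOfRecordV4P N θ Mstar 𝔯 x) (sectEStYOfRecordV7 N θ Mstar 𝔢₀ x) U B)) →
      ∃ (Λ : Finset (B1Eq324BenfattoLemma.Site (θ.d₆ + 1 + (θ.d₆ + 1) + 1))) (e' : σ × TrIdx N ≃ ↥Λ),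
        ((gaussianFieldOfKernel fun u w => if h : u ∈ Λ ∧ w ∈ Λ then
            ((Matrix.reindex e' e'
              (Matrix.of fun p q : σ × TrIdx N =>
                  trReForm (trBasis N p.2) (((CsDeltaCPstY x (lettersYOfRecordV4P N θ Mstar 𝔯 x)
            (sectEStYOfRecordV7 N θ Mstar 𝔢₀ x) U).restrictScalars ℝ)
                    (Pi.single (ι q.1) (trBasis N q.2)) (ι p.1))))⁻¹ :
                Matrix ↥Λ ↥Λ ℝ) ⟨u, h.1⟩ ⟨w, h.2⟩ else 0).map
            (fun (z : B1Eq324BenfattoLemma.Site (θ.d₆ + 1 + (θ.d₆ + 1) + 1) → ℝ) (q : σ × TrIdx N) => z ((e' q : ↥Λ) : B1Eq324BenfattoLemma.Site (θ.d₆ + 1 + (θ.d₆ + 1) + 1))) =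
          gaussianFieldOfKernel fun p q =>
            ((Matrix.of fun p q : σ × TrIdx N =>
                trReForm (trBasis N p.2) (((CsDeltaCPstY x (lettersYOfRecordV4P N θ Mstar 𝔯 x)
            (sectEStYOfRecordV7 N θ Mstar 𝔢₀ x) U).restrictScalars ℝ)
                  (Pi.single (ι q.1) (trBasis N q.2)) (ι p.1)))⁻¹ :
              Matrix (σ × TrIdx N) (σ × TrIdx N) ℝ) p q) ∧
        (∀ p : ℝ, 0 ≤ p →
          ((fun (z : B1Eq324BenfattoLemma.Site (θ.d₆ + 1 + (θ.d₆ + 1) + 1) → ℝ) (q : σ × TrIdx N) => z ((e' q : ↥Λ) : B1Eq324BenfattoLemma.Site (θ.d₆ + 1 + (θ.d₆ + 1) + 1))) ⁻¹'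
              {ω : σ × TrIdx N → ℝ | ∀ q, |ω q| ≤ p}) =ᵐ[gaussianFieldOfKernel fun u w => if h : u ∈ Λ ∧ w ∈ Λ then
                ((Matrix.reindex e' e'
                  (Matrix.of fun p q : σ × TrIdx N =>
                      trReForm (trBasis N p.2) (((CsDeltaCPstY x (lettersYOfRecordV4P N θ Mstar 𝔯 x)
            (sectEStYOfRecordV7 N θ Mstar 𝔢₀ x) U).restrictScalars ℝ)
                        (Pi.single (ι q.1) (trBasis N q.2)) (ι p.1))))⁻¹ :
                    Matrix ↥Λ ↥Λ ℝ) ⟨u, h.1⟩ ⟨w, h.2⟩ else 0]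
            smallFieldSet Λ p) ∧
        ∀ (s : ℕ) (I J : Finset (B1Eq324BenfattoLemma.Site (θ.d₆ + 1 + (θ.d₆ + 1) + 1))) (𝔞 : Coef (θ.d₆ + 1 + (θ.d₆ + 1) + 1)),
          I.Nonempty → J ⊆ I → J ⊆ Λ → coefSup s D 𝔞 J ≤ c * η ^ σ' →
          0 < ∫ z, cutoffBoltzmann (hamiltonian s D ϰ 𝔞 J) I (B10.pFun b₀ p₀ η) z ∂(gaussianFieldOfKernel fun u w => if h : u ∈ Λ ∧ w ∈ Λ then
              ((Matrix.reindex e' e'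
                (Matrix.of fun p q : σ × TrIdx N =>
                    trReForm (trBasis N p.2) (((CsDeltaCPstY x (lettersYOfRecordV4P N θ Mstar 𝔯 x)
            (sectEStYOfRecordV7 N θ Mstar 𝔢₀ x) U).restrictScalars ℝ)
                      (Pi.single (ι q.1) (trBasis N q.2)) (ι p.1))))⁻¹ :
                  Matrix ↥Λ ↥Λ ℝ) ⟨u, h.1⟩ ⟨w, h.2⟩ else 0) ∧
            |Real.log (∫ z, cutoffBoltzmann (hamiltonian s D ϰ 𝔞 J) I (B10.pFun b₀ p₀ η) z ∂(gaussianFieldOfKernel fun u w =>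
                if h : u ∈ Λ ∧ w ∈ Λ then
                  ((Matrix.reindex e' e'
                    (Matrix.of fun p q : σ × TrIdx N =>
                        trReForm (trBasis N p.2) (((CsDeltaCPstY x (lettersYOfRecordV4P N θ Mstar 𝔯 x)
            (sectEStYOfRecordV7 N θ Mstar 𝔢₀ x) U).restrictScalars ℝ)
                          (Pi.single (ι q.1) (trBasis N q.2)) (ι p.1))))⁻¹ :
                      Matrix ↥Λ ↥Λ ℝ) ⟨u, h.1⟩ ⟨w, h.2⟩ else 0)) -
              cumulantSum (gaussianFieldOfKernel fun u w => if h : u ∈ Λ ∧ w ∈ Λ then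
                  ((Matrix.reindex e' e'
                    (Matrix.of fun p q : σ × TrIdx N =>
                        trReForm (trBasis N p.2) (((CsDeltaCPstY x (lettersYOfRecordV4P N θ Mstar 𝔯 x)
            (sectEStYOfRecordV7 N θ Mstar 𝔢₀ x) U).restrictScalars ℝ)
                          (Pi.single (ι q.1) (trBasis N q.2)) (ι p.1))))⁻¹ :
                      Matrix ↥Λ ↥Λ ℝ) ⟨u, h.1⟩ ⟨w, h.2⟩ else 0)
                (hamiltonian s D ϰ 𝔞 J) t| ≤ C * η ^ κ' * I.card := by
  obtain ⟨M₄, δ, a₀, BP, hM₄, hδ, ha₀, hBP, H⟩ := h26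
  obtain ⟨b₁, hb₁⟩ := eq324_CsDeltaCPstY_lettersYOfRecordV4P_sectEStYOfRecordV7_trBasis_of_ineq3132_of_small_onΛst_on_unit N θ Mstar 𝔯 𝔢₀ 𝔢st 𝔴 𝔈 hγ₀ hBP.le
    hKJ hδ hδV hsmall t D hϰ hp₀ hσ hc hκ hκσ
  refine ⟨M₄, δ, a₀, hM₄, hδ, ha₀, b₁, fun b₀ hb₀ => ?_⟩
  obtain ⟨C, hC, hE⟩ := hb₁ b₀ hb₀
  refine ⟨C, hC, ?_⟩
  intro η hη hηle x _ hMx α₀ hα₀ hMa U h335 h336 hV hΔ2 hD2J σ _ _ _ ι hι hιT hJker hco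
  exact hE η hη hηle x specialUnitaryUnits_le_unitaryUnits U (B9BackgroundsKLevelV1P.mem_of_reg335P x.toKIdx h335.1) hV hΔ2 hD2J ι hι hιT
    (H x hMx α₀ hα₀ hMa U h335 h336).2 hJker hco


/-- ★★★★ **THE (3.24) STAR DOOR OF RECORD MODULO NODE N06's SOCKET OF RECORD** — the first N08 door that reads node N06 through the SAME hypothesis the K1 face of
node N24 (p705524) and node N07 consume and dag-n06-d's STAR-edition certificate (ED.71∕72) concludes: `h06 : B9LeafX (Y9OfRecordP N θ M⋆ (opsYNuStOfRecordV4PE N θ M⋆ 𝔯 𝔢st 𝔴 𝔈))`.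
Its field `h06.s3132` ([B9] (3.132) for `(QG̃Q*)⁻¹ ∕ (QG₁Q*)⁻¹` fed `G′_phys`, print's cube class) IS the hypothesis `h26` of the family door above at `c35 := c35Y` (every
carrier projection of `Y9OfRecordP` is definitional).  What stays displayed per background is NOT node N06's numbered∕X rows: the small averaged field of record, [5]'s
reality `IsSymmTr ((𝔯 x).Δ2 U)` ∕ `IsSymmTr ((𝔢₀ x).D2J U)`, the 𝒥-row on STAR pairs at print's rate `δ` ((3.136)-type, through a generic `(𝔢₀ x).D2J`), and the Δ_k-row
`γ₀` on print's `V`-constrained STAR subspace (G-B9-09, [B9] p. 428 «localizing … methods of Sect. B»).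
[cite: Balaban1985BackgroundPropagators, (3.132) p.422, Thm 3.12 p.423, (3.35)–(3.36) p.396, (3.155)–(3.158) pp.427–428, Thms 3.1–3.15 pp.397–432 (the leaf);
Balaban1984PropagatorsII, (2.149) p.249, (2.3) p.224, Lemma 2.4 p.245; Balaban1985Averaging, (125)–(126) p.36; Balaban1985UV3, (24) p.262, pp.271–272; Balaban1982Higgs1,
(3.24) p.616; BenfattoEtAl1978, Lemma (4.5)–(4.7) p.152 (class form; bent window, presentation and coordinates ours)] -/
theorem eq324_CsDeltaCPstY_lettersYOfRecordV4P_sectEStYOfRecordV7_trBasis_of_b9LeafX_of_small_onΛst_on_unit (N : ℕ) [NeZero N] (θ : Stage3Params) (Mstar : ℕ)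
    (𝔯 : ResY N θ Mstar) (𝔢₀ : SectEY N θ Mstar) (𝔢st : SectEStY N θ Mstar) (𝔴 : RWEY N θ Mstar) (𝔈 : ExpsY N θ Mstar) 
    (h06 : B9LeafX (Y9OfRecordP N θ Mstar (opsYNuStOfRecordV4PE N θ Mstar 𝔯 𝔢st 𝔴 𝔈)))
    {γ₀ KJ δV : ℝ} (hγ₀ : 0 < γ₀) (hKJ : 0 ≤ KJ) (hδV : 0 ≤ δV)
    (hsmall : (((θ.ℓ₆ + 1 : ℕ) : ℝ)) ^ (θ.d₆ + 1) * (2 * δV * (((θ.ℓ₆ + 1 : ℕ) + (θ.d₆ + 1) * θ.ℓ₆ : ℕ) : ℝ)) < 1)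
    (t D : ℕ) {ϰ : ℝ} (hϰ : 0 < ϰ) {p₀ σ' c κ' : ℝ} (hp₀ : 2 / 3 < p₀) (hσ : 0 < σ') (hc : 0 ≤ c) (hκ : 0 < κ') (hκσ : κ' < σ' * (t + 1)) :
    ∃ M₄ δ a₀ : ℝ, 0 < M₄ ∧ 0 < δ ∧ 0 < a₀ ∧ ∃ b₁ : ℝ, ∀ b₀ : ℝ, b₁ < b₀ → ∃ C : ℝ, 0 ≤ C ∧ ∀ η : ℝ, 0 < η → η ≤ 1 →
      ∀ (x : MemberY θ.d₆ θ.ℓ₆ θ.hd' θ.hL' θ.b₀ θ.b₁ Mstar) [DecidableEq (IBondY x.toKIdx)], M₄ ≤ (geo9Y x).M →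
      ∀ α₀ : ℝ, 0 < α₀ → (geo9Y x).M * α₀ ≤ a₀ →
      ∀ (U : CfgY (Matrix (Fin N) (Fin N) ℂ) x.toKIdx),
        (bg9YP (Matrix (Fin N) (Fin N) ℂ) (specialUnitaryUnits (Fin N)) x).Reg335 B9PinGeometryKLevelV1.c35Y α₀ U →
        (bg9YP (Matrix (Fin N) (Fin N) ℂ) (specialUnitaryUnits (Fin N)) x).Reg336 B9PinGeometryKLevelV1.c35Y α₀ U →
        (∀ b : UBondY x, ‖((avYOfRecord x U b : (Matrix (Fin N) (Fin N) ℂ)ˣ) : Matrix (Fin N) (Fin N) ℂ) - 1‖ ≤ δV) →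
        IsSymmTr (fun _ => (1 : ℝ)) ((𝔯 x).Δ2 U) → IsSymmTr (fun _ => (1 : ℝ)) ((𝔢₀ x).D2J U) →
      ∀ {σ : Type} [Fintype σ] [DecidableEq σ] [Nonempty σ] (ι : σ → IBondY x.toKIdx), Function.Injective ι → (∀ s, lamTstY x (ι s)) →
        (∀ (u v : IBondY x.toKIdx) (E : Matrix (Fin N) (Fin N) ℂ), inΛstY x u → inΛstY x v →
          ‖((((etaDY x : ℝ) : ℂ) • (aY x.toKIdx + (𝔢₀ x).D2J U)).restrictScalars ℝ) (Pi.single v E) u‖ ≤ KJ * ‖E‖ * Real.exp (-(δ * unitDistY x u v))) →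
        (∀ B : IBondY x.toKIdx → Matrix (Fin N) (Fin N) ℂ, (∀ q, ¬ inΛstY x q → B q = 0) → (∀ q, IsAxialY x q → B q = 0) →
          (∀ c' : CBondStY x, Q1Y x (avYOfRecord x) U c'.1 B = 0) →
          γ₀ * trIP (fun _ => (1 : ℝ)) B B ≤
            trIP (fun _ => (1 : ℝ)) B (deltaKPstY x (lettersYOfRecordV4P N θ Mstar 𝔯 x) (sectEStYOfRecordV7 N θ Mstar 𝔢₀ x) U B)) →
      ∃ (Λ : Finset (B1Eq324BenfattoLemma.Site (θ.d₆ + 1 + (θ.d₆ + 1) + 1))) (e' : σ × TrIdx N ≃ ↥Λ),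
        ((gaussianFieldOfKernel fun u w => if h : u ∈ Λ ∧ w ∈ Λ then
            ((Matrix.reindex e' e'
              (Matrix.of fun p q : σ × TrIdx N =>
                  trReForm (trBasis N p.2) (((CsDeltaCPstY x (lettersYOfRecordV4P N θ Mstar 𝔯 x)
            (sectEStYOfRecordV7 N θ Mstar 𝔢₀ x) U).restrictScalars ℝ)
                    (Pi.single (ι q.1) (trBasis N q.2)) (ι p.1))))⁻¹ :
                Matrix ↥Λ ↥Λ ℝ) ⟨u, h.1⟩ ⟨w, h.2⟩ else 0).map
            (fun (z : B1Eq324BenfattoLemma.Site (θ.d₆ + 1 + (θ.d₆ + 1) + 1) → ℝ) (q : σ × TrIdx N) => z ((e' q : ↥Λ) : B1Eq324BenfattoLemma.Site (θ.d₆ + 1 + (θ.d₆ + 1) + 1))) =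
          gaussianFieldOfKernel fun p q =>
            ((Matrix.of fun p q : σ × TrIdx N =>
                trReForm (trBasis N p.2) (((CsDeltaCPstY x (lettersYOfRecordV4P N θ Mstar 𝔯 x)
            (sectEStYOfRecordV7 N θ Mstar 𝔢₀ x) U).restrictScalars ℝ)
                  (Pi.single (ι q.1) (trBasis N q.2)) (ι p.1)))⁻¹ :
              Matrix (σ × TrIdx N) (σ × TrIdx N) ℝ) p q) ∧
        (∀ p : ℝ, 0 ≤ p →
          ((fun (z : B1Eq324BenfattoLemma.Site (θ.d₆ + 1 + (θ.d₆ + 1) + 1) → ℝ) (q : σ × TrIdx N) => z ((e' q : ↥Λ) : B1Eq324BenfattoLemma.Site (θ.d₆ + 1 + (θ.d₆ + 1) + 1))) ⁻¹'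
              {ω : σ × TrIdx N → ℝ | ∀ q, |ω q| ≤ p}) =ᵐ[gaussianFieldOfKernel fun u w => if h : u ∈ Λ ∧ w ∈ Λ then
                ((Matrix.reindex e' e'
                  (Matrix.of fun p q : σ × TrIdx N =>
                      trReForm (trBasis N p.2) (((CsDeltaCPstY x (lettersYOfRecordV4P N θ Mstar 𝔯 x)
            (sectEStYOfRecordV7 N θ Mstar 𝔢₀ x) U).restrictScalars ℝ)
                        (Pi.single (ι q.1) (trBasis N q.2)) (ι p.1))))⁻¹ :
                    Matrix ↥Λ ↥Λ ℝ) ⟨u, h.1⟩ ⟨w, h.2⟩ else 0]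
            smallFieldSet Λ p) ∧
        ∀ (s : ℕ) (I J : Finset (B1Eq324BenfattoLemma.Site (θ.d₆ + 1 + (θ.d₆ + 1) + 1))) (𝔞 : Coef (θ.d₆ + 1 + (θ.d₆ + 1) + 1)),
          I.Nonempty → J ⊆ I → J ⊆ Λ → coefSup s D 𝔞 J ≤ c * η ^ σ' →
          0 < ∫ z, cutoffBoltzmann (hamiltonian s D ϰ 𝔞 J) I (B10.pFun b₀ p₀ η) z ∂(gaussianFieldOfKernel fun u w => if h : u ∈ Λ ∧ w ∈ Λ then
              ((Matrix.reindex e' e'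
                (Matrix.of fun p q : σ × TrIdx N =>
                    trReForm (trBasis N p.2) (((CsDeltaCPstY x (lettersYOfRecordV4P N θ Mstar 𝔯 x)
            (sectEStYOfRecordV7 N θ Mstar 𝔢₀ x) U).restrictScalars ℝ)
                      (Pi.single (ι q.1) (trBasis N q.2)) (ι p.1))))⁻¹ :
                  Matrix ↥Λ ↥Λ ℝ) ⟨u, h.1⟩ ⟨w, h.2⟩ else 0) ∧
            |Real.log (∫ z, cutoffBoltzmann (hamiltonian s D ϰ 𝔞 J) I (B10.pFun b₀ p₀ η) z ∂(gaussianFieldOfKernel fun u w =>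
                if h : u ∈ Λ ∧ w ∈ Λ then
                  ((Matrix.reindex e' e'
                    (Matrix.of fun p q : σ × TrIdx N =>
                        trReForm (trBasis N p.2) (((CsDeltaCPstY x (lettersYOfRecordV4P N θ Mstar 𝔯 x)
            (sectEStYOfRecordV7 N θ Mstar 𝔢₀ x) U).restrictScalars ℝ)
                          (Pi.single (ι q.1) (trBasis N q.2)) (ι p.1))))⁻¹ :
                      Matrix ↥Λ ↥Λ ℝ) ⟨u, h.1⟩ ⟨w, h.2⟩ else 0)) -
              cumulantSum (gaussianFieldOfKernel fun u w => if h : u ∈ Λ ∧ w ∈ Λ then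
                  ((Matrix.reindex e' e'
                    (Matrix.of fun p q : σ × TrIdx N =>
                        trReForm (trBasis N p.2) (((CsDeltaCPstY x (lettersYOfRecordV4P N θ Mstar 𝔯 x)
            (sectEStYOfRecordV7 N θ Mstar 𝔢₀ x) U).restrictScalars ℝ)
                          (Pi.single (ι q.1) (trBasis N q.2)) (ι p.1))))⁻¹ :
                      Matrix ↥Λ ↥Λ ℝ) ⟨u, h.1⟩ ⟨w, h.2⟩ else 0)
                (hamiltonian s D ϰ 𝔞 J) t| ≤ C * η ^ κ' * I.card :=
  eq324_CsDeltaCPstY_lettersYOfRecordV4P_sectEStYOfRecordV7_trBasis_of_stmt3132Printed_P_of_small_onΛst_on_unit N θ Mstar 𝔯 𝔢₀ 𝔢st 𝔴 𝔈 h06.s3132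
    hγ₀ hKJ hδV hsmall t D hϰ hp₀ hσ hc hκ hκσ

end DoorRecordP

end Literature.MathematicalPhysics.QuantumFieldTheory.Balaban1983to89.B1Eq324BenfattoClassSectEMemberPrecisionDoorRecordV4P

end
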